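import Literature.Computability.QuantumComplexity.GluedTrees
import Mathlib.MeasureTheory.Integral.IntervalIntegral.FundThmCalculus
import Mathlib.Analysis.SpecialFunctions.Trigonometric.Bounds
import Mathlib.Analysis.SpecialFunctions.Exponential
import Mathlib.Algebra.Order.Chebyshev
import Mathlib.Analysis.Real.Pi.Bounds

/-!
# Theorem 3 of Childs–Cleve–Deotto–Farhi–Gutmann–Spielman (2003), proved

Companion ("Proofs" sibling) of `GluedTrees.lean`: it discharges the named fact
`ChildsEtAl2003_thm3` (the quantum walk on the glued trees `G'_n(σ)` finds the EXIT with
time-averaged probability `> (1 - ε)/(2(n+1))` for times uniform in `[0, (n+1)⁴/(2ε)]`, `n` large)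
as `theorem ChildsEtAl2003_thm3_holds`, with threshold `n₀ = 8`. Everything here is PROVED; no
new named fact is introduced. Source read: A. M. Childs, R. Cleve, E. Deotto, E. Farhi,
S. Gutmann, D. A. Spielman, *Exponential algorithmic speedup by a quantum walk*, STOC 2003
(arXiv:quant-ph/0209131, `paper:arxiv-quant-ph_0209131`), §3.3 (p. 8) and §3.4 (pp. 9–10:
Lemma 1, Lemma 2, Theorem 3).

## The printed proof and its rendering (`N := n + 1`; the paper's `n` is our `N`)

| step in print | here |
|---|---|
| §3.3 "the column subspace is invariant under `H`"; `⟨col j|H|col j±1⟩ = 1`, `√2` at the centre (`γ = 1/√2`) | `Thm3.lineH` on the sites `L n = Bool × Fin (n+1)` (side, depth); `Thm3.H_mul_Q : H Q = Q J` from the neighbour counts `Thm3.card_S` (2 children, 1 parent, 2 glued partners); `Thm3.exitAmplitude_eq` |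
| §3.4 eigenstates `⟨col j|E⟩ = sin pj`, `± sin p(2n+1-j)`, `E = 2 cos p`, quantisation `sin((n+1)p)/sin(np) = ±√2`; the two extra eigenvalues `± (√2 + 1/√2)` ("`p = ik`") | `Thm3.vec`, `Thm3.lineH_mulVec_vec` via the Chebyshev recursion `Thm3.u` (`U_j(cos p) sin p = sin (j+1)p`), matching condition `U_N(x) = ±√2 U_{N-1}(x)`; trigonometric roots `Thm3.pM`, `Thm3.pP`, hyperbolic root `Thm3.xh ∈ [1, 5/4]` |
| Lemma 2: `ΔE > 2π²/((1+√2)n³) + O(n⁻⁴) > 8/n³` (asymptotics read off a figure) | REPLACED by explicit brackets: the `-` root of the `l`-th cluster lies in `[(lπ + s_l/2)/(N+1), (lπ - s_l/3)/N]`, the `+` root in `[(lπ + s_l/3)/N, ((l+1)π - s_l/2)/(N+1)]` (`s_l = min (sin lπ/(N+1)) (sin (l+1)π/(N+1))`), endpoint signs from `sin θ ≤ θ`, `cos θ ≥ 1 - θ²/2`; all `2N` half-eigenvalues are pairwise `≥ 3/N³` apart for `N ≥ 9` (`Thm3.g_sep`), so `ΔE ≥ 6/N³` |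
| Lemma 1: `(1/τ)∫₀^τ |⟨2n|e^{-iHt}|1⟩|² ≥ Σ_E |⟨E|1⟩|⁴ - 2/(τΔE) ≥ 1/(2n) - 2/(τΔE)` (parity `⟨E|1⟩ = ±⟨E|2n⟩`, Cauchy–Schwarz) | explicit spectral decomposition `J = V D Vᵀ` (`Thm3.lineH_eq_conj`; orthogonality from distinct eigenvalues, completeness by counting `2N` eigenpairs), `e^{cJ} = V e^{cD} Vᵀ` (`Matrix.exp_conj`), amplitude `Σ_k c_k e^{-itE_k}` with `Σ|c_k| = 1`, `Σ c_k² ≥ 1/(2N)`; the time average in REAL form `∫₀^τ ‖Σ c_k e^{-itE_k}‖² ≥ τ Σ c_k² - (Σ|c_k|)²/ΔE` (`Thm3.integral_norm_sq_lower`: pairing `(k,l)` with `(l,k)` gives `sin(ωτ)/ω`, so `1/(τΔE)` replaces the printed `2/(τΔE)`) |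
| Theorem 3: `τ = n⁴/(2ε) ≥ 4n/(εΔE)` | average `≥ 1/(2N) - N³/(6τ) = 1/(2N) - ε/(3N) > (1-ε)/(2N)` |

## Deviations from print (all in the direction of proving more carefully what is used)

* Lemma 2's asymptotic expansion is replaced by finite brackets valid for every `N ≥ 9`; the true
  gap is `≈ 4√2π²/N³`, far above the `4/N³` the real-form Lemma 1 needs, so crude constants
  (`θ_l = s_l/3`, `ψ_l = s_l/2`) suffice.
* The spectral theorem is not invoked abstractly: the `2N` eigenpairs are written down and shown
  complete by orthogonality and a cardinality count, which also gives the parity of the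
  EXIT/ENTRANCE components for free.

## References

* [ChildsEtAl2003] A. M. Childs, R. Cleve, E. Deotto, E. Farhi, S. Gutmann, D. A. Spielman,
  Exponential algorithmic speedup by a quantum walk, STOC 2003, 59–68 (arXiv:quant-ph/0209131),
  §3.3 (column subspace, eq. for `⟨col j|H|col j+1⟩`), §3.4 (Lemma 1, Lemma 2, Theorem 3).
-/

noncomputable section

open Real Set
open scoped Matrix

namespace Literature.Computability.QuantumComplexity.GluedTrees.Thm3

/-! ### P-I. The sequence `u j x = U_j(x)` (Chebyshev polynomials of the second kind) -/

/-- `u j x = U_j(x)`: `u 0 x = 1`, `u 1 x = 2x`, `u (j+2) x = 2x·u (j+1) x - u j x`. [folklore] -/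
def u : ℕ → ℝ → ℝ
  | 0, _ => 1
  | 1, x => 2 * x
  | (j + 2), x => 2 * x * u (j + 1) x - u j x

/-- `U_0 = 1`. [folklore] -/
@[simp] theorem u_zero (x : ℝ) : u 0 x = 1 := rfl
/-- `U_1(x) = 2x`. [folklore] -/
@[simp] theorem u_one (x : ℝ) : u 1 x = 2 * x := rfl
/-- The Chebyshev recursion `U_{j+2} = 2x U_{j+1} - U_j`. [folklore] -/
theorem u_add_two (j : ℕ) (x : ℝ) : u (j + 2) x = 2 * x * u (j + 1) x - u j x := rfl

/-- Each `U_j` is continuous (a polynomial). [folklore] -/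
theorem continuous_u : ∀ j : ℕ, Continuous (u j)
  | 0 => continuous_const
  | 1 => by
    show Continuous fun x : ℝ => 2 * x
    fun_prop
  | (j + 2) => by
    have h1 := continuous_u (j + 1)
    have h0 := continuous_u j
    show Continuous fun x : ℝ => 2 * x * u (j + 1) x - u j x
    fun_prop

/-- `U_j(cos p) · sin p = sin ((j+1) p)`. [folklore] -/
theorem u_cos_mul_sin : ∀ (j : ℕ) (p : ℝ), u j (cos p) * sin p = sin ((j + 1) * p)
  | 0, p => by simp
  | 1, p => by
    simp only [u_one, Nat.cast_one]
    rw [show ((1 : ℝ) + 1) * p = 2 * p by ring, sin_two_mul]; ring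
  | (j + 2), p => by
    have h1 := u_cos_mul_sin (j + 1) p
    have h0 := u_cos_mul_sin j p
    rw [u_add_two, sub_mul, mul_assoc, h1, h0]
    have e2 : ((↑(j + 2) : ℝ) + 1) * p = ((↑(j + 1) : ℝ) + 1) * p + p := by push_cast; ring
    have e0 : ((j : ℝ) + 1) * p = ((↑(j + 1) : ℝ) + 1) * p - p := by push_cast; ring
    rw [e2, e0, sin_add, sin_sub]
    ring

/-- `U_j(1) = j + 1`. [folklore] -/
theorem u_at_one : ∀ j : ℕ, u j 1 = j + 1
  | 0 => by simp
  | 1 => by simp only [u_one, Nat.cast_one]; norm_num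
  | (j + 2) => by
    rw [u_add_two, u_at_one (j + 1), u_at_one j]; push_cast; ring

/-- `U_j(5/4) = (2/3)(2^(j+1) - 2^(-(j+1)))`. [folklore] -/
theorem u_at_five_fourths : ∀ j : ℕ, u j (5 / 4) = 2 / 3 * (2 ^ (j + 1) - (1 / 2) ^ (j + 1))
  | 0 => by simp only [u_zero]; norm_num
  | 1 => by simp only [u_one]; norm_num
  | (j + 2) => by
    rw [u_add_two, u_at_five_fourths (j + 1), u_at_five_fourths j]; ring

/-- Parity `U_j(-x) = (-1)^j U_j(x)`. [folklore] -/
theorem u_neg : ∀ (j : ℕ) (x : ℝ), u j (-x) = (-1) ^ j * u j x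
  | 0, x => by simp
  | 1, x => by simp
  | (j + 2), x => by
    rw [u_add_two, u_add_two, u_neg (j + 1) x, u_neg j x]; ring

/-! ### P-III (analytic part). The quantisation function and its sign at bracket endpoints -/

/-- `F s N p = sin ((N+1) p) - s √2 sin (N p)`: the quantisation condition of the line.
[cite: ChildsEtAl2003, §3.4] -/
def F (s : ℝ) (N : ℕ) (p : ℝ) : ℝ := sin ((N + 1) * p) - s * √2 * sin (N * p)

/-- The quantisation function is continuous. [folklore] -/
theorem continuous_F (s : ℝ) (N : ℕ) : Continuous (F s N) := by
  unfold F; fun_prop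

/-- At a root `p` of `F s (n+1)` with `sin p ≠ 0`, `x = cos p` satisfies the matching condition
`u (n+1) x = s √2 u n x`. [cite: ChildsEtAl2003, §3.4] -/
theorem u_match_of_F_eq_zero {s : ℝ} {n : ℕ} {p : ℝ} (hp : sin p ≠ 0) (hF : F s (n + 1) p = 0) :
    u (n + 1) (cos p) = s * √2 * u n (cos p) := by
  have h1 := u_cos_mul_sin (n + 1) p
  have h0 := u_cos_mul_sin n p
  unfold F at hF
  apply mul_right_cancel₀ hp
  rw [h1, mul_assoc, h0]
  push_cast at hF ⊢
  linarith

/-- Expansion (X1): `p = (lπ - θ)/N`. [folklore] -/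
theorem F_neg_one_at_sub {N : ℕ} (l : ℕ) (hN : 0 < N) (θ : ℝ) :
    F (-1) N ((l * π - θ) / N) =
      (-1) ^ l * (cos θ * sin ((l * π - θ) / N) - sin θ * (cos ((l * π - θ) / N) + √2)) := by
  set p := (l * π - θ) / N with hp
  have hN' : (N : ℝ) ≠ 0 := by exact_mod_cast hN.ne'
  have hNp : (N : ℝ) * p = l * π - θ := by
    rw [hp]; field_simp
  unfold F
  rw [add_mul, one_mul, hNp, sin_add, sin_nat_mul_pi_sub, cos_nat_mul_pi_sub]
  ring

/-- Expansion (X2): `p = (lπ + θ)/N`. [folklore] -/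
theorem F_one_at_add {N : ℕ} (l : ℕ) (hN : 0 < N) (θ : ℝ) :
    F 1 N ((l * π + θ) / N) =
      (-1) ^ l * (cos θ * sin ((l * π + θ) / N) - sin θ * (√2 - cos ((l * π + θ) / N))) := by
  set p := (l * π + θ) / N with hp
  have hN' : (N : ℝ) ≠ 0 := by exact_mod_cast hN.ne'
  have hNp : (N : ℝ) * p = θ + l * π := by
    rw [hp]; field_simp; ring
  unfold F
  rw [add_mul, one_mul, hNp, sin_add, sin_add_nat_mul_pi, cos_add_nat_mul_pi]
  ring

/-- Expansion (X3): `p = (lπ + ψ)/(N+1)`. [folklore] -/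
theorem F_neg_one_at_add' {N : ℕ} (l : ℕ) (ψ : ℝ) :
    F (-1) N ((l * π + ψ) / (N + 1)) =
      (-1) ^ l * (sin ψ * (1 + √2 * cos ((l * π + ψ) / (N + 1)))
        - √2 * cos ψ * sin ((l * π + ψ) / (N + 1))) := by
  set p := (l * π + ψ) / (N + 1) with hp
  have hN' : (N : ℝ) + 1 ≠ 0 := by positivity
  have hN1 : ((N : ℝ) + 1) * p = ψ + l * π := by
    rw [hp]; field_simp; ring
  have hNp : (N : ℝ) * p = (ψ + l * π) - p := by rw [← hN1]; ring
  unfold F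
  rw [hNp, hN1, sin_sub, sin_add_nat_mul_pi, cos_add_nat_mul_pi]
  ring

/-- Expansion (X4): `p = ((l+1)π - ψ)/(N+1)`. [folklore] -/
theorem F_one_at_sub' {N : ℕ} (l : ℕ) (ψ : ℝ) :
    F 1 N ((((l + 1 : ℕ) : ℝ) * π - ψ) / (N + 1)) =
      (-1) ^ l * (sin ψ * (1 - √2 * cos ((((l + 1 : ℕ) : ℝ) * π - ψ) / (N + 1)))
        - √2 * cos ψ * sin ((((l + 1 : ℕ) : ℝ) * π - ψ) / (N + 1))) := by
  set p := (((l + 1 : ℕ) : ℝ) * π - ψ) / (N + 1) with hp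
  have hN' : (N : ℝ) + 1 ≠ 0 := by positivity
  have hN1 : ((N : ℝ) + 1) * p = ((l + 1 : ℕ) : ℝ) * π - ψ := by
    rw [hp]; field_simp
  have hNp : (N : ℝ) * p = (((l + 1 : ℕ) : ℝ) * π - ψ) - p := by rw [← hN1]; ring
  unfold F
  rw [hNp, sin_sub _ p, hN1, sin_nat_mul_pi_sub, cos_nat_mul_pi_sub]
  ring

/-! Sign lemmas (E1)–(E4): elementary inequalities. -/

/-- `√2 < 3/2`. [folklore] -/
theorem sqrt_two_lt_three_halves : √2 < 3 / 2 := by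
  rw [Real.sqrt_lt' (by norm_num)]; norm_num

/-- `1 < √2`. [folklore] -/
theorem one_lt_sqrt_two : (1 : ℝ) < √2 := by
  rw [Real.lt_sqrt (by norm_num)]; norm_num

/-- (E1)/(E2): with `θ = s/3`, `0 < s ≤ sp`, `s ≤ 1` and `c ≤ 1`:
`0 < cos θ · sp - sin θ (√2 + c)`. [folklore] -/
theorem sign_core_theta {s sp c : ℝ} (hs : 0 < s) (hs1 : s ≤ 1) (hsp : s ≤ sp) (hc : c ≤ 1) :
    0 < cos (s / 3) * sp - sin (s / 3) * (√2 + c) := by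
  have hθ0 : 0 ≤ s / 3 := by positivity
  have hsin : sin (s / 3) ≤ s / 3 := sin_le hθ0
  have hsin0 : 0 ≤ sin (s / 3) :=
    sin_nonneg_of_nonneg_of_le_pi hθ0 (by linarith [Real.pi_gt_three])
  have hcos : 1 - (s / 3) ^ 2 / 2 ≤ cos (s / 3) := one_sub_sq_div_two_le_cos
  have hcos' : 17 / 18 ≤ cos (s / 3) := by nlinarith
  have h2 := sqrt_two_lt_three_halves
  have hA : 17 / 18 * s ≤ cos (s / 3) * sp := by nlinarith
  have hB1 : sin (s / 3) * (√2 + c) ≤ sin (s / 3) * (5 / 2) :=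
    mul_le_mul_of_nonneg_left (by linarith) hsin0
  have hB2 : sin (s / 3) * (5 / 2) ≤ s / 3 * (5 / 2) := by nlinarith
  nlinarith

/-- (E3)/(E4): with `ψ = s/2`, `0 < s ≤ sp`, `s ≤ 1` and `c ≤ 1`:
`sin ψ (1 + √2 c) - √2 cos ψ · sp < 0`. [folklore] -/
theorem sign_core_psi {s sp c : ℝ} (hs : 0 < s) (hs1 : s ≤ 1) (hsp : s ≤ sp) (hc : c ≤ 1) :
    sin (s / 2) * (1 + √2 * c) - √2 * cos (s / 2) * sp < 0 := by
  have hψ0 : 0 ≤ s / 2 := by positivity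
  have hsin : sin (s / 2) ≤ s / 2 := sin_le hψ0
  have hsin0 : 0 ≤ sin (s / 2) :=
    sin_nonneg_of_nonneg_of_le_pi hψ0 (by linarith [Real.pi_gt_three])
  have hcos : 1 - (s / 2) ^ 2 / 2 ≤ cos (s / 2) := one_sub_sq_div_two_le_cos
  have hcos' : 7 / 8 ≤ cos (s / 2) := by nlinarith
  have hr2 : 0 < √2 := by positivity
  have hsq : √2 * √2 = 2 := Real.mul_self_sqrt (by norm_num)
  have h32 : 4 < 3 * √2 := by nlinarith [one_lt_sqrt_two]
  have hA1 : sin (s / 2) * (1 + √2 * c) ≤ sin (s / 2) * (1 + √2) :=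
    mul_le_mul_of_nonneg_left (by nlinarith) hsin0
  have hA2 : sin (s / 2) * (1 + √2) ≤ s / 2 * (1 + √2) :=
    mul_le_mul_of_nonneg_right hsin (by positivity)
  have hB : √2 * (7 / 8) * s ≤ √2 * cos (s / 2) * sp := by
    have : (7 / 8) * s ≤ cos (s / 2) * sp := by nlinarith
    nlinarith
  nlinarith

/-! ### Brackets for the trigonometric roots -/

/-- On a subinterval `[a, b] ⊆ [0, π]`, `sin` is bounded below by its values at the endpoints.
[folklore] -/
theorem min_sin_le_sin {a b p : ℝ} (ha : 0 ≤ a) (hb : b ≤ π) (hap : a ≤ p) (hpb : p ≤ b) :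
    min (sin a) (sin b) ≤ sin p := by
  rcases le_or_gt p (π / 2) with h | h
  · refine (min_le_left _ _).trans ?_
    exact sin_le_sin_of_le_of_le_pi_div_two (by linarith [pi_pos]) h hap
  · refine (min_le_right _ _).trans ?_
    rw [← sin_pi_sub b, ← sin_pi_sub p]
    exact sin_le_sin_of_le_of_le_pi_div_two (by linarith) (by linarith) (by linarith)

/-- `cos a - cos b ≥ 2 m (b - a) / π` when `0 ≤ a ≤ b ≤ π` and `0 ≤ m ≤ sin a, sin b`. [folklore] -/
theorem cos_sub_cos_ge {a b m : ℝ} (ha : 0 ≤ a) (hab : a ≤ b) (hb : b ≤ π) (hm : 0 ≤ m)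
    (hma : m ≤ sin a) (hmb : m ≤ sin b) : 2 * m * (b - a) / π ≤ cos a - cos b := by
  rw [cos_sub_cos]
  have h1 : m ≤ sin ((a + b) / 2) :=
    (le_min hma hmb).trans (min_sin_le_sin ha hb (by linarith) (by linarith))
  have h2 : 2 / π * ((b - a) / 2) ≤ sin ((b - a) / 2) :=
    mul_le_sin (by linarith) (by linarith)
  have h3 : sin ((a - b) / 2) = -sin ((b - a) / 2) := by
    rw [← sin_neg]; congr 1; ring
  rw [h3]
  have h0 : 0 ≤ 2 / π * ((b - a) / 2) := by positivity
  calc 2 * m * (b - a) / π = 2 * (m * (2 / π * ((b - a) / 2))) := by ring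
    _ ≤ 2 * (sin ((a + b) / 2) * sin ((b - a) / 2)) := by
      have := mul_le_mul h1 h2 h0 (hm.trans h1)
      linarith
    _ = -2 * sin ((a + b) / 2) * -sin ((b - a) / 2) := by ring

section brackets

variable (N : ℕ)

/-- `s_l = min (sin (lπ/(N+1))) (sin ((l+1)π/(N+1)))`: a lower bound for `sin` on the window
`[lπ/(N+1), (l+1)π/(N+1)]` containing the `l`-th pair of brackets. [folklore] -/
def sl (l : ℕ) : ℝ := min (sin (l * π / (N + 1))) (sin ((l + 1) * π / (N + 1)))

/-- Left end of the bracket for the root of `F (-1) N` just left of `lπ/N`.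
[cite: ChildsEtAl2003, §3.4] -/
def loM (l : ℕ) : ℝ := (l * π + sl N l / 2) / (N + 1)
/-- Right end of the bracket for the root of `F (-1) N` just left of `lπ/N`.
[cite: ChildsEtAl2003, §3.4] -/
def hiM (l : ℕ) : ℝ := (l * π - sl N l / 3) / N
/-- Left end of the bracket for the root of `F 1 N` just right of `lπ/N`.
[cite: ChildsEtAl2003, §3.4] -/
def loP (l : ℕ) : ℝ := (l * π + sl N l / 3) / N
/-- Right end of the bracket for the root of `F 1 N` just right of `lπ/N`.
[cite: ChildsEtAl2003, §3.4] -/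
def hiP (l : ℕ) : ℝ := (((l + 1 : ℕ) : ℝ) * π - sl N l / 2) / (N + 1)

variable {N} {l : ℕ}

/-- `s_l ≤ sin p` on the window `[lπ/(N+1), (l+1)π/(N+1)]` (concavity of `sin`). [folklore] -/
theorem sl_le_sin {p : ℝ} (hp1 : l * π / (N + 1) ≤ p) (hp2 : p ≤ (l + 1) * π / (N + 1))
    (hl : l + 1 ≤ N) : sl N l ≤ sin p := by
  unfold sl
  apply min_sin_le_sin (by positivity) ?_ hp1 hp2
  rw [div_le_iff₀ (by positivity)]
  have : (l : ℝ) + 1 ≤ N := by exact_mod_cast hl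
  nlinarith [pi_pos]

/-- `s_l > 0` for `1 ≤ l ≤ N-1`. [folklore] -/
theorem sl_pos (hl0 : 1 ≤ l) (hl : l + 1 ≤ N) : 0 < sl N l := by
  have hl' : (l : ℝ) + 1 ≤ N := by exact_mod_cast hl
  have hl0' : (1 : ℝ) ≤ l := by exact_mod_cast hl0
  unfold sl
  apply lt_min
  · apply sin_pos_of_pos_of_lt_pi (by positivity)
    rw [div_lt_iff₀ (by positivity)]; nlinarith [pi_pos]
  · apply sin_pos_of_pos_of_lt_pi (by positivity)
    rw [div_lt_iff₀ (by positivity)]; nlinarith [pi_pos]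

/-- `s_l ≤ 1`. [folklore] -/
theorem sl_le_one : sl N l ≤ 1 := (min_le_left _ _).trans (sin_le_one _)

/-- `s_l (N+1) ≤ l π`. [folklore] -/
theorem sl_mul_le_left : sl N l * (N + 1) ≤ l * π := by
  have h : sl N l ≤ l * π / (N + 1) := (min_le_left _ _).trans (sin_le (by positivity))
  rwa [le_div_iff₀ (by positivity)] at h

/-- `s_l (N+1) ≤ (N - l) π`. [folklore] -/
theorem sl_mul_le_right (hl : l + 1 ≤ N) : sl N l * (N + 1) ≤ (N - l) * π := by
  have hl' : (l : ℝ) + 1 ≤ N := by exact_mod_cast hl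
  have h : sl N l ≤ (N - l) * π / (N + 1) := by
    refine (min_le_right _ _).trans ?_
    have : ((l : ℝ) + 1) * π / (N + 1) = π - (N - l) * π / (N + 1) := by
      field_simp; ring
    rw [this, sin_pi_sub]
    exact sin_le (div_nonneg (by nlinarith [pi_pos]) (by positivity))
  rwa [le_div_iff₀ (by positivity)] at h

/-! Window inequalities (all for `1 ≤ l`, `l + 1 ≤ N`). -/

/-- `lπ/(N+1) ≤ loM`. [folklore] -/
theorem left_le_loM (hl0 : 1 ≤ l) (hl : l + 1 ≤ N) : l * π / (N + 1) ≤ loM N l := by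
  unfold loM
  have := sl_pos hl0 hl
  exact div_le_div_of_nonneg_right (by linarith) (by positivity)

/-- The bracket `[loM, hiM]` is a genuine interval. [folklore] -/
theorem loM_le_hiM (hl0 : 1 ≤ l) (hl : l + 1 ≤ N) : loM N l ≤ hiM N l := by
  unfold loM hiM
  have hs := sl_pos hl0 hl
  have h1 := sl_mul_le_left (N := N) (l := l)
  have hN : (0 : ℝ) < N := by
    have : (1 : ℝ) + 1 ≤ N := by exact_mod_cast (show 1 + 1 ≤ N by omega)
    linarith
  rw [div_le_div_iff₀ (by positivity) hN]
  have hlpi : 0 ≤ (l : ℝ) * π := by positivity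
  nlinarith

/-- `hiM ≤ lπ/N`. [folklore] -/
theorem hiM_le_mid (hl0 : 1 ≤ l) (hl : l + 1 ≤ N) : hiM N l ≤ l * π / N := by
  unfold hiM
  have := sl_pos hl0 hl
  exact div_le_div_of_nonneg_right (by linarith) (by positivity)

/-- `lπ/N ≤ (l+1)π/(N+1)` for `l + 1 ≤ N`. [folklore] -/
theorem mid_le_right (hl : l + 1 ≤ N) : (l : ℝ) * π / N ≤ (l + 1) * π / (N + 1) := by
  have hl' : (l : ℝ) + 1 ≤ N := by exact_mod_cast hl
  have hN : (0 : ℝ) < N := by linarith [(Nat.cast_nonneg l : (0 : ℝ) ≤ l)]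
  rw [div_le_div_iff₀ hN (by positivity)]
  nlinarith [pi_pos]

/-- `lπ/N ≤ loP`. [folklore] -/
theorem mid_le_loP (hl0 : 1 ≤ l) (hl : l + 1 ≤ N) : (l : ℝ) * π / N ≤ loP N l := by
  unfold loP
  have := sl_pos hl0 hl
  exact div_le_div_of_nonneg_right (by linarith) (by positivity)

/-- The bracket `[loP, hiP]` is a genuine interval. [folklore] -/
theorem loP_le_hiP (hl0 : 1 ≤ l) (hl : l + 1 ≤ N) : loP N l ≤ hiP N l := by
  unfold loP hiP
  have hs := sl_pos hl0 hl
  have h1 := sl_mul_le_right (N := N) (l := l) hl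
  have hl' : (l : ℝ) + 1 ≤ N := by exact_mod_cast hl
  have hN : (0 : ℝ) < N := by linarith [(Nat.cast_nonneg l : (0 : ℝ) ≤ l)]
  rw [div_le_div_iff₀ hN (by positivity)]
  push_cast
  nlinarith [pi_pos]

/-- `hiP ≤ (l+1)π/(N+1)`. [folklore] -/
theorem hiP_le_right (hl0 : 1 ≤ l) (hl : l + 1 ≤ N) : hiP N l ≤ (l + 1) * π / (N + 1) := by
  unfold hiP
  have := sl_pos hl0 hl
  push_cast
  exact div_le_div_of_nonneg_right (by linarith) (by positivity)

/-! Signs at the bracket endpoints. -/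

/-- Sign of `F (-1) N` at the left end of the `-` bracket: `(-1)^l F < 0` (expansion (X3) and
(E3)). [cite: ChildsEtAl2003, §3.4] -/
theorem sign_loM (hl0 : 1 ≤ l) (hl : l + 1 ≤ N) : (-1) ^ l * F (-1) N (loM N l) < 0 := by
  have hwin1 := left_le_loM (N := N) hl0 hl
  have hwin2 : loM N l ≤ (l + 1) * π / (N + 1) :=
    (loM_le_hiM hl0 hl).trans ((hiM_le_mid hl0 hl).trans (mid_le_right hl))
  have hsin := sl_le_sin hwin1 hwin2 hl
  have key := sign_core_psi (sl_pos hl0 hl) sl_le_one hsin (cos_le_one (loM N l))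
  have hx := F_neg_one_at_add' (N := N) l (sl N l / 2)
  have e : (l * π + sl N l / 2) / (N + 1) = loM N l := rfl
  rw [e] at hx
  rw [hx, ← mul_assoc, ← pow_add, ← two_mul, pow_mul]
  norm_num
  linarith

/-- Sign of `F (-1) N` at the right end of the `-` bracket: `(-1)^l F > 0` (expansion (X1) and
(E1)). [cite: ChildsEtAl2003, §3.4] -/
theorem sign_hiM (hl0 : 1 ≤ l) (hl : l + 1 ≤ N) : 0 < (-1) ^ l * F (-1) N (hiM N l) := by
  have hwin1 : l * π / (N + 1) ≤ hiM N l := (left_le_loM hl0 hl).trans (loM_le_hiM hl0 hl)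
  have hwin2 : hiM N l ≤ (l + 1) * π / (N + 1) := (hiM_le_mid hl0 hl).trans (mid_le_right hl)
  have hsin := sl_le_sin hwin1 hwin2 hl
  have key := sign_core_theta (sl_pos hl0 hl) sl_le_one hsin (cos_le_one (hiM N l))
  have hN : 0 < N := by omega
  have hx := F_neg_one_at_sub (N := N) l hN (sl N l / 3)
  have e : (l * π - sl N l / 3) / N = hiM N l := rfl
  rw [e] at hx
  rw [hx, ← mul_assoc, ← pow_add, ← two_mul, pow_mul]
  norm_num
  linarith

/-- Sign of `F 1 N` at the left end of the `+` bracket: `(-1)^l F > 0` (expansion (X2) and (E2)).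
[cite: ChildsEtAl2003, §3.4] -/
theorem sign_loP (hl0 : 1 ≤ l) (hl : l + 1 ≤ N) : 0 < (-1) ^ l * F 1 N (loP N l) := by
  have hwin1 : l * π / (N + 1) ≤ loP N l :=
    (left_le_loM hl0 hl).trans ((loM_le_hiM hl0 hl).trans ((hiM_le_mid hl0 hl).trans
      (mid_le_loP hl0 hl)))
  have hwin2 : loP N l ≤ (l + 1) * π / (N + 1) :=
    (loP_le_hiP hl0 hl).trans (hiP_le_right hl0 hl)
  have hsin := sl_le_sin hwin1 hwin2 hl
  have key := sign_core_theta (sl_pos hl0 hl) sl_le_one hsin (neg_le.mp (neg_one_le_cos (loP N l)))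
  have hN : 0 < N := by omega
  have hx := F_one_at_add (N := N) l hN (sl N l / 3)
  have e : (l * π + sl N l / 3) / N = loP N l := rfl
  rw [e] at hx
  rw [hx, ← mul_assoc, ← pow_add, ← two_mul, pow_mul]
  norm_num
  linarith

/-- Sign of `F 1 N` at the right end of the `+` bracket: `(-1)^l F < 0` (expansion (X4) and (E4)).
[cite: ChildsEtAl2003, §3.4] -/
theorem sign_hiP (hl0 : 1 ≤ l) (hl : l + 1 ≤ N) : (-1) ^ l * F 1 N (hiP N l) < 0 := by
  have hwin1 : l * π / (N + 1) ≤ hiP N l :=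
    (left_le_loM hl0 hl).trans ((loM_le_hiM hl0 hl).trans ((hiM_le_mid hl0 hl).trans
      ((mid_le_loP hl0 hl).trans (loP_le_hiP hl0 hl))))
  have hwin2 : hiP N l ≤ (l + 1) * π / (N + 1) := hiP_le_right hl0 hl
  have hsin := sl_le_sin hwin1 hwin2 hl
  have key := sign_core_psi (sl_pos hl0 hl) sl_le_one hsin (neg_le.mp (neg_one_le_cos (hiP N l)))
  have hx := F_one_at_sub' (N := N) l (sl N l / 2)
  have e : (((l + 1 : ℕ) : ℝ) * π - sl N l / 2) / (N + 1) = hiP N l := rfl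
  rw [e] at hx
  rw [hx, ← mul_assoc, ← pow_add, ← two_mul, pow_mul]
  norm_num
  linarith

/-! The roots. -/

/-- A root of `F (-1) N` (quantisation condition `sin((N+1)p) = -√2 sin(Np)`) in the `l`-th
`-` bracket, by the intermediate value theorem. [cite: ChildsEtAl2003, §3.4] -/
theorem exists_rootM (hl0 : 1 ≤ l) (hl : l + 1 ≤ N) :
    ∃ p, loM N l ≤ p ∧ p ≤ hiM N l ∧ F (-1) N p = 0 := by
  have hc : ContinuousOn (fun p ↦ (-1 : ℝ) ^ l * F (-1) N p) (Icc (loM N l) (hiM N l)) :=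
    (continuous_const.mul (continuous_F _ _)).continuousOn
  obtain ⟨p, ⟨hp1, hp2⟩, hp⟩ := intermediate_value_Icc (loM_le_hiM hl0 hl) hc
    ⟨(sign_loM hl0 hl).le, (sign_hiM hl0 hl).le⟩
  refine ⟨p, hp1, hp2, ?_⟩
  simpa using hp

/-- A root of `F 1 N` (quantisation condition with `+√2`) in the `l`-th `+` bracket, by the
intermediate value theorem. [cite: ChildsEtAl2003, §3.4] -/
theorem exists_rootP (hl0 : 1 ≤ l) (hl : l + 1 ≤ N) :
    ∃ p, loP N l ≤ p ∧ p ≤ hiP N l ∧ F 1 N p = 0 := by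
  have hc : ContinuousOn (fun p ↦ (-1 : ℝ) ^ l * F 1 N p) (Icc (loP N l) (hiP N l)) :=
    (continuous_const.mul (continuous_F _ _)).continuousOn
  obtain ⟨p, ⟨hp1, hp2⟩, hp⟩ := intermediate_value_Icc' (loP_le_hiP hl0 hl) hc
    ⟨(sign_hiP hl0 hl).le, (sign_loP hl0 hl).le⟩
  refine ⟨p, hp1, hp2, ?_⟩
  simpa using hp

/-- The uniform lower bound `s_* = sin (π/(N+1)) ≤ sin p` on `[π/(N+1), Nπ/(N+1)]`. [folklore] -/
theorem sstar_le_sin {p : ℝ} (h1 : π / (N + 1) ≤ p) (h2 : p ≤ N * π / (N + 1)) :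
    sin (π / (N + 1)) ≤ sin p := by
  have hb : (N : ℝ) * π / (N + 1) = π - π / (N + 1) := by field_simp; ring
  have := min_sin_le_sin (a := π / (N + 1)) (b := N * π / (N + 1)) (by positivity)
    (by rw [hb]; linarith [show (0:ℝ) < π / (N + 1) by positivity]) h1 h2
  rwa [hb, sin_pi_sub, min_self] at this

/-- `sin (π/(N+1)) ≤ s_l` for `1 ≤ l ≤ N-1`. [folklore] -/
theorem sstar_le_sl (hl0 : 1 ≤ l) (hl : l + 1 ≤ N) : sin (π / (N + 1)) ≤ sl N l := by
  have hl' : (l : ℝ) + 1 ≤ N := by exact_mod_cast hl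
  have hl0' : (1 : ℝ) ≤ l := by exact_mod_cast hl0
  unfold sl
  apply le_min
  · apply sstar_le_sin
    · exact div_le_div_of_nonneg_right (by nlinarith [pi_pos]) (by positivity)
    · exact div_le_div_of_nonneg_right (by nlinarith [pi_pos]) (by positivity)
  · apply sstar_le_sin
    · exact div_le_div_of_nonneg_right (by nlinarith [pi_pos]) (by positivity)
    · exact div_le_div_of_nonneg_right (by nlinarith [pi_pos]) (by positivity)

/-- The chosen root of `F (-1) N` in the `l`-th bracket (junk `0` outside `1 ≤ l ≤ N - 1`).
[cite: ChildsEtAl2003, §3.4] -/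
def pM (N l : ℕ) : ℝ :=
  if h : 1 ≤ l ∧ l + 1 ≤ N then Classical.choose (exists_rootM (N := N) h.1 h.2) else 0

/-- The chosen root of `F 1 N` in the `l`-th bracket (junk `0` outside `1 ≤ l ≤ N - 1`).
[cite: ChildsEtAl2003, §3.4] -/
def pP (N l : ℕ) : ℝ :=
  if h : 1 ≤ l ∧ l + 1 ≤ N then Classical.choose (exists_rootP (N := N) h.1 h.2) else 0

/-- Defining property of `pM`: it lies in its bracket and is a root of `F (-1) N`. [cite:
ChildsEtAl2003, §3.4] -/
theorem pM_spec (hl0 : 1 ≤ l) (hl : l + 1 ≤ N) :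
    loM N l ≤ pM N l ∧ pM N l ≤ hiM N l ∧ F (-1) N (pM N l) = 0 := by
  unfold pM; rw [dif_pos ⟨hl0, hl⟩]; exact Classical.choose_spec (exists_rootM hl0 hl)

/-- Defining property of `pP`: it lies in its bracket and is a root of `F 1 N`. [cite:
ChildsEtAl2003, §3.4] -/
theorem pP_spec (hl0 : 1 ≤ l) (hl : l + 1 ≤ N) :
    loP N l ≤ pP N l ∧ pP N l ≤ hiP N l ∧ F 1 N (pP N l) = 0 := by
  unfold pP; rw [dif_pos ⟨hl0, hl⟩]; exact Classical.choose_spec (exists_rootP hl0 hl)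

/-- Location of `pM`: `lπ/(N+1) ≤ pM ≤ lπ/N - (s_l/3)/N`. [cite: ChildsEtAl2003, §3.4] -/
theorem pM_bounds (hl0 : 1 ≤ l) (hl : l + 1 ≤ N) :
    l * π / (N + 1) ≤ pM N l ∧ pM N l ≤ (l * π - sl N l / 3) / N := by
  obtain ⟨h1, h2, -⟩ := pM_spec (N := N) hl0 hl
  exact ⟨(left_le_loM hl0 hl).trans h1, h2⟩

/-- Location of `pP`: `lπ/N + (s_l/3)/N ≤ pP ≤ (l+1)π/(N+1)`. [cite: ChildsEtAl2003, §3.4] -/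
theorem pP_bounds (hl0 : 1 ≤ l) (hl : l + 1 ≤ N) :
    (l * π + sl N l / 3) / N ≤ pP N l ∧ pP N l ≤ (l + 1) * π / (N + 1) := by
  obtain ⟨h1, h2, -⟩ := pP_spec (N := N) hl0 hl
  exact ⟨h1, h2.trans (hiP_le_right hl0 hl)⟩

/-- `pM l ∈ [π/(N+1), Nπ/(N+1)]`. [folklore] -/
theorem pM_window (hl0 : 1 ≤ l) (hl : l + 1 ≤ N) :
    π / (N + 1) ≤ pM N l ∧ pM N l ≤ N * π / (N + 1) := by
  obtain ⟨h1, h2⟩ := pM_bounds (N := N) hl0 hl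
  have hl' : (l : ℝ) + 1 ≤ N := by exact_mod_cast hl
  have hl0' : (1 : ℝ) ≤ l := by exact_mod_cast hl0
  refine ⟨le_trans ?_ h1, h2.trans ((hiM_le_mid hl0 hl).trans ((mid_le_right hl).trans ?_))⟩
  · exact div_le_div_of_nonneg_right (by nlinarith [pi_pos]) (by positivity)
  · exact div_le_div_of_nonneg_right (by nlinarith [pi_pos]) (by positivity)

/-- `pP l ∈ [π/(N+1), Nπ/(N+1)]`. [folklore] -/
theorem pP_window (hl0 : 1 ≤ l) (hl : l + 1 ≤ N) :
    π / (N + 1) ≤ pP N l ∧ pP N l ≤ N * π / (N + 1) := by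
  obtain ⟨h1, h2⟩ := pP_bounds (N := N) hl0 hl
  have hl' : (l : ℝ) + 1 ≤ N := by exact_mod_cast hl
  have hl0' : (1 : ℝ) ≤ l := by exact_mod_cast hl0
  refine ⟨le_trans ?_ ((left_le_loM hl0 hl).trans ((loM_le_hiM hl0 hl).trans
    ((hiM_le_mid hl0 hl).trans ((mid_le_loP hl0 hl).trans h1)))), h2.trans ?_⟩
  · exact div_le_div_of_nonneg_right (by nlinarith [pi_pos]) (by positivity)
  · exact div_le_div_of_nonneg_right (by nlinarith [pi_pos]) (by positivity)

/-- Points of the window are positive. [folklore] -/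
theorem window_pos {p : ℝ} (h1 : π / (N + 1) ≤ p) : 0 < p :=
  lt_of_lt_of_le (by positivity) h1

/-- Points of the window are `< π`. [folklore] -/
theorem window_lt_pi {p : ℝ} (h2 : p ≤ N * π / (N + 1)) : p < π := by
  refine lt_of_le_of_lt h2 ?_
  rw [div_lt_iff₀ (by positivity)]; nlinarith [pi_pos]

/-- The matching condition at the trigonometric roots. [cite: ChildsEtAl2003, §3.4] -/
theorem u_match_pM {n l : ℕ} (hl0 : 1 ≤ l) (hl : l + 1 ≤ n + 1) :
    u (n + 1) (cos (pM (n + 1) l)) = (-1) * √2 * u n (cos (pM (n + 1) l)) := by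
  obtain ⟨-, -, hF⟩ := pM_spec (N := n + 1) hl0 hl
  obtain ⟨w1, w2⟩ := pM_window (N := n + 1) hl0 hl
  refine u_match_of_F_eq_zero (sin_pos_of_pos_of_lt_pi (window_pos w1) ?_).ne' ?_
  · exact window_lt_pi (by exact_mod_cast w2)
  · exact_mod_cast hF

/-- The matching condition `U_{n+1}(x) = √2 U_n(x)` at `x = cos (pP l)`. [cite: ChildsEtAl2003,
§3.4] -/
theorem u_match_pP {n l : ℕ} (hl0 : 1 ≤ l) (hl : l + 1 ≤ n + 1) :
    u (n + 1) (cos (pP (n + 1) l)) = 1 * √2 * u n (cos (pP (n + 1) l)) := by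
  obtain ⟨-, -, hF⟩ := pP_spec (N := n + 1) hl0 hl
  obtain ⟨w1, w2⟩ := pP_window (N := n + 1) hl0 hl
  refine u_match_of_F_eq_zero (sin_pos_of_pos_of_lt_pi (window_pos w1) ?_).ne' ?_
  · exact window_lt_pi (by exact_mod_cast w2)
  · exact_mod_cast hF

/-- `sin (π/(N+1)) ≥ 3/(N+1)` for `N ≥ 6` (from `sin y ≥ y - y³/6`). [folklore] -/
theorem three_div_le_sstar (hN : 6 ≤ N) : 3 / ((N : ℝ) + 1) ≤ sin (π / (N + 1)) := by
  have hN' : (6 : ℝ) ≤ N := by exact_mod_cast hN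
  set y := π / ((N : ℝ) + 1) with hy
  have hy0 : 0 ≤ y := by positivity
  have h1 : y - y ^ 3 / 6 ≤ sin y := sin_ge_sub_cube hy0
  have hyle : y ≤ 1 / 2 := by
    rw [hy, div_le_iff₀ (by positivity)]; nlinarith [pi_lt_d2]
  -- y - y³/6 ≥ y (1 - 1/24) and y ≥ 3.14/(N+1)
  have h2 : 3 / ((N : ℝ) + 1) ≤ y * (1 - 1 / 24) := by
    rw [hy, div_mul_eq_mul_div, div_le_div_iff_of_pos_right (by positivity)]
    nlinarith [pi_gt_d2]
  have h3 : y * (1 - 1 / 24) ≤ y - y ^ 3 / 6 := by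
    have hy2 : y ^ 2 ≤ 1 / 4 := by nlinarith
    have : y ^ 3 ≤ y * (1 / 4) := by
      calc y ^ 3 = y * y ^ 2 := by ring
        _ ≤ y * (1 / 4) := mul_le_mul_of_nonneg_left hy2 hy0
    nlinarith
  linarith

end brackets

/-! ### The hyperbolic root -/

/-- The hyperbolic root: `U_{n+1}(x) = √2 U_n(x)` has a solution `x ∈ [1, 5/4]` for `n ≥ 2`
(the eigenvalue `2x → √2 + 1/√2` of the paper, "let `p = ik` with `k` real"). [cite: ChildsEtAl2003, §3.4] -/
theorem exists_root_hyp {n : ℕ} (hn : 2 ≤ n) :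
    ∃ x : ℝ, 1 ≤ x ∧ x ≤ 5 / 4 ∧ u (n + 1) x = √2 * u n x := by
  have hc : ContinuousOn (fun x ↦ u (n + 1) x - √2 * u n x) (Icc 1 (5 / 4)) :=
    ((continuous_u _).sub (continuous_const.mul (continuous_u _))).continuousOn
  have hn' : (2 : ℝ) ≤ n := by exact_mod_cast hn
  have h1 : u (n + 1) 1 - √2 * u n 1 ≤ 0 := by
    rw [u_at_one, u_at_one]
    push_cast
    nlinarith [one_lt_sqrt_two, Real.mul_self_sqrt (show (0:ℝ) ≤ 2 by norm_num)]
  have h2 : 0 ≤ u (n + 1) (5 / 4) - √2 * u n (5 / 4) := by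
    rw [u_at_five_fourths, u_at_five_fourths]
    have hp : (0 : ℝ) < 2 ^ (n + 1) := by positivity
    have hq : (0 : ℝ) < (1 / 2) ^ (n + 1) := by positivity
    have hq1 : ((1 : ℝ) / 2) ^ (n + 1) ≤ 1 / 2 := by
      calc ((1 : ℝ) / 2) ^ (n + 1) ≤ (1 / 2) ^ 1 := pow_le_pow_of_le_one (by norm_num) (by norm_num) (by omega)
        _ = 1 / 2 := by norm_num
    have hp1 : (2 : ℝ) ≤ 2 ^ (n + 1) := by
      calc (2 : ℝ) = 2 ^ 1 := by norm_num
        _ ≤ 2 ^ (n + 1) := pow_le_pow_right₀ (by norm_num) (by omega)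
    rw [pow_succ (2 : ℝ) (n + 1), pow_succ ((1 : ℝ) / 2) (n + 1)]
    nlinarith [sqrt_two_lt_three_halves, one_lt_sqrt_two]
  obtain ⟨x, ⟨hx1, hx2⟩, hx⟩ := intermediate_value_Icc (by norm_num) hc ⟨h1, h2⟩
  exact ⟨x, hx1, hx2, by simpa [sub_eq_zero] using hx⟩

/-- The chosen hyperbolic root (junk `1` for `n < 2`). [cite: ChildsEtAl2003, §3.4] -/
def xh (n : ℕ) : ℝ := if h : 2 ≤ n then Classical.choose (exists_root_hyp h) else 1

/-- Defining property of the hyperbolic root: `1 ≤ x_h ≤ 5/4` and `U_{n+1}(x_h) = √2 U_n(x_h)`.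
[cite: ChildsEtAl2003, §3.4] -/
theorem xh_spec {n : ℕ} (hn : 2 ≤ n) :
    1 ≤ xh n ∧ xh n ≤ 5 / 4 ∧ u (n + 1) (xh n) = √2 * u n (xh n) := by
  unfold xh; rw [dif_pos hn]; exact Classical.choose_spec (exists_root_hyp hn)

/-! ### Gaps between consecutive roots (in the variable `x = cos p`, resp. `±x_h`) -/

section gaps

variable {n : ℕ}

/-- Numeric facts for `N = n + 1 ≥ 9`. [folklore] -/
theorem num1 (hn : 8 ≤ n) : 3 / ((n : ℝ) + 1) ^ 3 ≤ 2 / ((n : ℝ) + 1 + 1) ^ 2 := by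
  have hn' : (8 : ℝ) ≤ n := by exact_mod_cast hn
  rw [div_le_div_iff₀ (by positivity) (by positivity)]
  nlinarith [mul_nonneg (mul_nonneg (sub_nonneg.2 hn') (sub_nonneg.2 hn')) (sub_nonneg.2 hn')]

/-- Numeric fact: `3/N³ ≤ 12/(π N (N+1)²)` for `N = n+1 ≥ 9`. [folklore] -/
theorem num2 (hn : 8 ≤ n) :
    3 / ((n : ℝ) + 1) ^ 3 ≤ 12 / (π * ((n : ℝ) + 1) * ((n : ℝ) + 1 + 1) ^ 2) := by
  have hn' : (8 : ℝ) ≤ n := by exact_mod_cast hn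
  rw [div_le_div_iff₀ (by positivity) (by positivity)]
  have hp := pi_lt_d2
  have h1 : 3 * (π * ((n : ℝ) + 1) * ((n : ℝ) + 1 + 1) ^ 2)
      ≤ 3 * (3.15 * ((n : ℝ) + 1) * ((n : ℝ) + 1 + 1) ^ 2) := by
    gcongr
  nlinarith [mul_nonneg (sub_nonneg.2 hn') (sub_nonneg.2 hn')]

/-- Numeric fact: `3/N³ ≤ 18/(π (N+1)³)` for `N = n+1 ≥ 9`. [folklore] -/
theorem num3 (hn : 8 ≤ n) : 3 / ((n : ℝ) + 1) ^ 3 ≤ 18 / (π * ((n : ℝ) + 1 + 1) ^ 3) := by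
  have hn' : (8 : ℝ) ≤ n := by exact_mod_cast hn
  rw [div_le_div_iff₀ (by positivity) (by positivity)]
  have hp := pi_lt_d2
  have h1 : 3 * (π * ((n : ℝ) + 1 + 1) ^ 3) ≤ 3 * (3.15 * ((n : ℝ) + 1 + 1) ^ 3) := by gcongr
  nlinarith [mul_nonneg (mul_nonneg (sub_nonneg.2 hn') (sub_nonneg.2 hn')) (sub_nonneg.2 hn')]

/-- `1 - cos (π/(N+1)) ≥ 2/(N+1)²`. [folklore] -/
theorem two_div_sq_le (n : ℕ) :
    2 / ((n : ℝ) + 1 + 1) ^ 2 ≤ 1 - cos (π / ((n : ℝ) + 1 + 1)) := by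
  have h := cos_le_one_sub_mul_cos_sq (x := π / ((n : ℝ) + 1 + 1))
    (by rw [abs_of_nonneg (by positivity)]; exact div_le_self pi_pos.le (by linarith))
  have e : 2 / π ^ 2 * (π / ((n : ℝ) + 1 + 1)) ^ 2 = 2 / ((n : ℝ) + 1 + 1) ^ 2 := by
    field_simp
  linarith

/-- `3/(N+1) ≤ sin (π/(N+1))` for `N = n + 1`, `n ≥ 8`. [folklore] -/
theorem sstar_ge (hn : 8 ≤ n) : 3 / ((n : ℝ) + 1 + 1) ≤ sin (π / ((n : ℝ) + 1 + 1)) := by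
  have := three_div_le_sstar (N := n + 1) (by omega)
  exact_mod_cast this

/-- Gap at the top: `x_h - cos (pM 1) ≥ 3/N³`. [cite: ChildsEtAl2003, Lemma 2] -/
theorem gap_top (hn : 8 ≤ n) : 3 / ((n : ℝ) + 1) ^ 3 ≤ xh n - cos (pM (n + 1) 1) := by
  obtain ⟨hx1, -, -⟩ := xh_spec (n := n) (by omega)
  obtain ⟨w1, w2⟩ := pM_window (N := n + 1) (l := 1) le_rfl (by omega)
  have hc : cos (pM (n + 1) 1) ≤ cos (π / ((n : ℝ) + 1 + 1)) := by
    apply cos_le_cos_of_nonneg_of_le_pi (by positivity) (window_lt_pi w2).le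
    exact_mod_cast w1
  linarith [num1 hn, two_div_sq_le n]

/-- Gap at the bottom: `cos (pP (N-1)) - (-x_h) ≥ 3/N³`. [cite: ChildsEtAl2003, Lemma 2] -/
theorem gap_bot (hn : 8 ≤ n) : 3 / ((n : ℝ) + 1) ^ 3 ≤ cos (pP (n + 1) n) - -xh n := by
  obtain ⟨hx1, -, -⟩ := xh_spec (n := n) (by omega)
  obtain ⟨w1, w2⟩ := pP_window (N := n + 1) (l := n) (by omega) le_rfl
  have hb : ((n + 1 : ℕ) : ℝ) * π / ((n + 1 : ℕ) + 1) = π - π / ((n : ℝ) + 1 + 1) := by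
    push_cast; field_simp; ring
  have hc : cos (π - π / ((n : ℝ) + 1 + 1)) ≤ cos (pP (n + 1) n) := by
    apply cos_le_cos_of_nonneg_of_le_pi (window_pos w1).le ?_ (by rw [← hb]; exact w2)
    linarith [show (0 : ℝ) < π / ((n : ℝ) + 1 + 1) by positivity]
  rw [cos_pi_sub] at hc
  linarith [num1 hn, two_div_sq_le n]

/-- Gap within a pair: `cos (pM l) - cos (pP l) ≥ 3/N³`. [cite: ChildsEtAl2003, Lemma 2] -/
theorem gap_within (hn : 8 ≤ n) {l : ℕ} (hl0 : 1 ≤ l) (hl : l + 1 ≤ n + 1) :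
    3 / ((n : ℝ) + 1) ^ 3 ≤ cos (pM (n + 1) l) - cos (pP (n + 1) l) := by
  obtain ⟨a1, a2⟩ := pM_window (N := n + 1) hl0 hl
  obtain ⟨b1, b2⟩ := pP_window (N := n + 1) hl0 hl
  obtain ⟨-, ha⟩ := pM_bounds (N := n + 1) hl0 hl
  obtain ⟨hb, -⟩ := pP_bounds (N := n + 1) hl0 hl
  have hs := sstar_ge hn
  have hsl : sin (π / ((n : ℝ) + 1 + 1)) ≤ sl (n + 1) l := by exact_mod_cast sstar_le_sl hl0 hl
  have hsa : sin (π / ((n : ℝ) + 1 + 1)) ≤ sin (pM (n + 1) l) := by exact_mod_cast sstar_le_sin a1 a2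
  have hsb : sin (π / ((n : ℝ) + 1 + 1)) ≤ sin (pP (n + 1) l) := by exact_mod_cast sstar_le_sin b1 b2
  have hdiff : 2 * sl (n + 1) l / 3 / ((n : ℝ) + 1) ≤ pP (n + 1) l - pM (n + 1) l := by
    have e : (↑l * π + sl (n + 1) l / 3) / ((n + 1 : ℕ) : ℝ) - (↑l * π - sl (n + 1) l / 3) / ((n + 1 : ℕ) : ℝ)
        = 2 * sl (n + 1) l / 3 / ((n : ℝ) + 1) := by push_cast; field_simp; ring
    linarith
  have hm0 : (0 : ℝ) ≤ 3 / ((n : ℝ) + 1 + 1) := by positivity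
  have hsl0 := sl_pos (N := n + 1) hl0 hl
  have hd0 : (0 : ℝ) ≤ 2 * sl (n + 1) l / 3 / ((n : ℝ) + 1) := by positivity
  have key := cos_sub_cos_ge (window_pos a1).le (by linarith)
    (window_lt_pi b2).le hm0 (hs.trans hsa) (hs.trans hsb)
  refine (num2 hn).trans (le_trans ?_ key)
  -- 12/(π N (N+1)²) ≤ 2 m (b - a)/π with m = 3/(N+1), b - a ≥ (2/3) s_l / N ≥ (2/3)(3/(N+1))/N
  have h1 : 2 * (3 / ((n : ℝ) + 1 + 1)) / 3 / ((n : ℝ) + 1) ≤ pP (n + 1) l - pM (n + 1) l := by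
    refine le_trans ?_ hdiff
    gcongr
    exact hs.trans hsl
  have e : 12 / (π * ((n : ℝ) + 1) * ((n : ℝ) + 1 + 1) ^ 2)
      = 2 * (3 / ((n : ℝ) + 1 + 1)) * (2 * (3 / ((n : ℝ) + 1 + 1)) / 3 / ((n : ℝ) + 1)) / π := by
    field_simp; ring
  rw [e]
  exact div_le_div_of_nonneg_right (mul_le_mul_of_nonneg_left h1 (by positivity)) pi_pos.le

/-- Gap between pairs: `cos (pP l) - cos (pM (l+1)) ≥ 3/N³`. [cite: ChildsEtAl2003, Lemma 2] -/
theorem gap_between (hn : 8 ≤ n) {l : ℕ} (hl0 : 1 ≤ l) (hl : l + 2 ≤ n + 1) :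
    3 / ((n : ℝ) + 1) ^ 3 ≤ cos (pP (n + 1) l) - cos (pM (n + 1) (l + 1)) := by
  have hl1 : l + 1 ≤ n + 1 := by omega
  obtain ⟨a1, a2⟩ := pP_window (N := n + 1) hl0 hl1
  obtain ⟨b1, b2⟩ := pM_window (N := n + 1) (l := l + 1) (by omega) hl
  obtain ⟨-, ha⟩ := pP_spec (N := n + 1) hl0 hl1
  obtain ⟨hb, -, -⟩ := pM_spec (N := n + 1) (l := l + 1) (by omega) hl
  have hs := sstar_ge hn
  have hsl : sin (π / ((n : ℝ) + 1 + 1)) ≤ sl (n + 1) l := by exact_mod_cast sstar_le_sl hl0 hl1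
  have hsl' : sin (π / ((n : ℝ) + 1 + 1)) ≤ sl (n + 1) (l + 1) := by
    exact_mod_cast sstar_le_sl (N := n + 1) (l := l + 1) (by omega) hl
  have hsa : sin (π / ((n : ℝ) + 1 + 1)) ≤ sin (pP (n + 1) l) := by exact_mod_cast sstar_le_sin a1 a2
  have hsb : sin (π / ((n : ℝ) + 1 + 1)) ≤ sin (pM (n + 1) (l + 1)) := by
    exact_mod_cast sstar_le_sin b1 b2
  have hdiff : (sl (n + 1) l + sl (n + 1) (l + 1)) / 2 / ((n : ℝ) + 1 + 1)
      ≤ pM (n + 1) (l + 1) - pP (n + 1) l := by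
    have e : loM (n + 1) (l + 1) - hiP (n + 1) l
        = (sl (n + 1) l + sl (n + 1) (l + 1)) / 2 / ((n : ℝ) + 1 + 1) := by
      unfold loM hiP; push_cast; field_simp; ring
    linarith
  have hm0 : (0 : ℝ) ≤ 3 / ((n : ℝ) + 1 + 1) := by positivity
  have hsl0 := sl_pos (N := n + 1) hl0 hl1
  have hsl0' := sl_pos (N := n + 1) (l := l + 1) (by omega) hl
  have hd0 : (0 : ℝ) ≤ (sl (n + 1) l + sl (n + 1) (l + 1)) / 2 / ((n : ℝ) + 1 + 1) := by positivity
  have key := cos_sub_cos_ge (window_pos a1).le (by linarith) (window_lt_pi b2).le hm0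
    (hs.trans hsa) (hs.trans hsb)
  refine (num3 hn).trans (le_trans ?_ key)
  have h1 : (3 / ((n : ℝ) + 1 + 1) + 3 / ((n : ℝ) + 1 + 1)) / 2 / ((n : ℝ) + 1 + 1)
      ≤ pM (n + 1) (l + 1) - pP (n + 1) l := by
    refine le_trans ?_ hdiff
    gcongr
    · exact hs.trans hsl
    · exact hs.trans hsl'
  have e : 18 / (π * ((n : ℝ) + 1 + 1) ^ 3)
      = 2 * (3 / ((n : ℝ) + 1 + 1)) *
        ((3 / ((n : ℝ) + 1 + 1) + 3 / ((n : ℝ) + 1 + 1)) / 2 / ((n : ℝ) + 1 + 1)) / π := by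
    field_simp; ring
  rw [e]
  exact div_le_div_of_nonneg_right (mul_le_mul_of_nonneg_left h1 (by positivity)) pi_pos.le

end gaps

/-! ### The rank-indexed list of all `2N` roots -/

/-- The angle attached to rank `r ∈ [1, 2N-2]`: odd ranks are `pM`, even ranks `pP`. [folklore] -/
def qr (n r : ℕ) : ℝ := if r % 2 = 1 then pM (n + 1) ((r + 1) / 2) else pP (n + 1) ((r + 1) / 2)

/-- The `r`-th largest value `x` (half-eigenvalue) of the line, `r = 0, …, 2n+1`.
[cite: ChildsEtAl2003, §3.4] -/
def g (n r : ℕ) : ℝ := if r = 0 then xh n else if r ≤ 2 * n then cos (qr n r) else -xh n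

/-- Odd ranks carry the `-` roots `pM`. [folklore] -/
theorem qr_odd (n m : ℕ) : qr n (2 * m + 1) = pM (n + 1) (m + 1) := by
  unfold qr
  have h1 : (2 * m + 1) % 2 = 1 := by omega
  have h2 : (2 * m + 1 + 1) / 2 = m + 1 := by omega
  rw [if_pos h1, h2]

/-- Even ranks `≥ 2` carry the `+` roots `pP`. [folklore] -/
theorem qr_even (n m : ℕ) : qr n (2 * m + 2) = pP (n + 1) (m + 1) := by
  unfold qr
  have h1 : ¬ (2 * m + 2) % 2 = 1 := by omega
  have h2 : (2 * m + 2 + 1) / 2 = m + 1 := by omega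
  rw [if_neg h1, h2]

/-- Rank `0` is the hyperbolic value `x_h`. [folklore] -/
theorem g_zero (n : ℕ) : g n 0 = xh n := by simp [g]

/-- `g (2m+1) = cos (pM (m+1))`. [folklore] -/
theorem g_odd {n m : ℕ} (hm : m + 1 ≤ n) : g n (2 * m + 1) = cos (pM (n + 1) (m + 1)) := by
  unfold g; rw [if_neg (by omega), if_pos (by omega), qr_odd]

/-- `g (2m+2) = cos (pP (m+1))`. [folklore] -/
theorem g_even {n m : ℕ} (hm : m + 1 ≤ n) : g n (2 * m + 2) = cos (pP (n + 1) (m + 1)) := by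
  unfold g; rw [if_neg (by omega), if_pos (by omega), qr_even]

/-- Rank `2n+1` is `-x_h`. [folklore] -/
theorem g_last (n : ℕ) : g n (2 * n + 1) = -xh n := by
  unfold g; rw [if_neg (by omega), if_neg (by omega)]

/-- Consecutive gap: `g r - g (r+1) ≥ 3/N³` for `r ≤ 2n`. [cite: ChildsEtAl2003, Lemma 2] -/
theorem g_gap_succ {n : ℕ} (hn : 8 ≤ n) {r : ℕ} (hr : r ≤ 2 * n) :
    3 / ((n : ℝ) + 1) ^ 3 ≤ g n r - g n (r + 1) := by
  rcases Nat.eq_zero_or_pos r with rfl | hr0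
  · rw [g_zero, show (0 + 1 : ℕ) = 2 * 0 + 1 from rfl, g_odd (by omega)]
    exact gap_top hn
  obtain ⟨m, rfl | rfl⟩ := Nat.even_or_odd' r
  · -- r = 2m even, m ≥ 1
    obtain ⟨m, rfl⟩ : ∃ m', m = m' + 1 := ⟨m - 1, by omega⟩
    rw [show 2 * (m + 1) = 2 * m + 2 by ring, g_even (by omega)]
    rcases Nat.lt_or_ge (2 * m + 2) (2 * n) with h | h
    · rw [show 2 * m + 2 + 1 = 2 * (m + 1) + 1 by ring, g_odd (by omega)]
      exact gap_between hn (by omega) (by omega)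
    · have hm : m + 1 = n := by omega
      subst hm
      rw [show 2 * m + 2 + 1 = 2 * (m + 1) + 1 by ring, g_last]
      exact gap_bot hn
  · -- r = 2m + 1 odd
    rw [g_odd (by omega), show 2 * m + 1 + 1 = 2 * m + 2 by ring, g_even (by omega)]
    exact gap_within hn (by omega) (by omega)

/-- Telescoped gap: `g r - g r' ≥ 3/N³` for `r < r' ≤ 2n+1`. [cite: ChildsEtAl2003, Lemma 2] -/
theorem g_gap {n : ℕ} (hn : 8 ≤ n) {r r' : ℕ} (hrr' : r < r') (hr' : r' ≤ 2 * n + 1) :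
    3 / ((n : ℝ) + 1) ^ 3 ≤ g n r - g n r' := by
  obtain ⟨d, rfl⟩ : ∃ d, r' = r + 1 + d := ⟨r' - (r + 1), by omega⟩
  induction d with
  | zero => simpa using g_gap_succ hn (by omega)
  | succ d ih =>
    have h1 := ih (by omega) (by omega)
    have h2 := g_gap_succ hn (r := r + 1 + d) (by omega)
    have h3 : (0 : ℝ) ≤ 3 / ((n : ℝ) + 1) ^ 3 := by positivity
    rw [show r + 1 + (d + 1) = r + 1 + d + 1 by ring]
    linarith

/-- Distinct ranks `≤ 2n+1` have values at least `3/(n+1)³` apart. [cite: ChildsEtAl2003, Lemma 2]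
-/
theorem g_sep {n : ℕ} (hn : 8 ≤ n) {r r' : ℕ} (hne : r ≠ r') (hr : r ≤ 2 * n + 1)
    (hr' : r' ≤ 2 * n + 1) : 3 / ((n : ℝ) + 1) ^ 3 ≤ |g n r - g n r'| := by
  rcases Nat.lt_or_gt_of_ne hne with h | h
  · exact (g_gap hn h hr').trans (le_abs_self _)
  · rw [abs_sub_comm]; exact (g_gap hn h hr).trans (le_abs_self _)

/-- The matching condition for every rank. [cite: ChildsEtAl2003, §3.4] -/
theorem u_match_g {n : ℕ} (hn : 8 ≤ n) {r : ℕ} (hr : r ≤ 2 * n + 1) :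
    u (n + 1) (g n r) = (-1) ^ r * √2 * u n (g n r) := by
  rcases Nat.eq_zero_or_pos r with rfl | hr0
  · rw [g_zero]; simpa using (xh_spec (n := n) (by omega)).2.2
  rcases Nat.lt_or_ge r (2 * n + 1) with h | h
  · obtain ⟨m, rfl | rfl⟩ := Nat.even_or_odd' r
    · obtain ⟨m, rfl⟩ : ∃ m', m = m' + 1 := ⟨m - 1, by omega⟩
      rw [show 2 * (m + 1) = 2 * m + 2 by ring, g_even (by omega)]
      rw [u_match_pP (by omega) (by omega)]
      congr 1
      rw [pow_add, pow_mul]; norm_num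
    · rw [g_odd (by omega), u_match_pM (by omega) (by omega)]
      rw [pow_add, pow_mul]; norm_num
  · have : r = 2 * n + 1 := by omega
    subst this
    rw [g_last, u_neg, u_neg, (xh_spec (n := n) (by omega)).2.2, pow_succ, pow_succ, pow_mul]
    norm_num
    ring

/-! ### P-II. The line (column space) and its eigenvectors -/

/-- The sites of the line: (side, depth). `(false, 0)` = ENTRANCE column, `(true, 0)` = EXIT column.
[cite: ChildsEtAl2003, §3.3] -/
abbrev L (n : ℕ) : Type := Bool × Fin (n + 1)

/-- The reduced Hamiltonian on the column space of `G'_n`: hopping `1` along each tree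
(`(b, j) — (b, j ± 1)`) and `√2` across the glued leaves (`(false, n) — (true, n)`).
[cite: ChildsEtAl2003, §3.3] -/
def lineH (n : ℕ) : Matrix (L n) (L n) ℝ := Matrix.of fun a b =>
  if a.1 = b.1 then (if (b.2 : ℕ) = a.2 + 1 ∨ (a.2 : ℕ) = b.2 + 1 then 1 else 0)
  else (if (a.2 : ℕ) = n ∧ (b.2 : ℕ) = n then √2 else 0)

/-- Entries of the reduced Hamiltonian, unfolded. [cite: ChildsEtAl2003, §3.3] -/
theorem lineH_apply (n : ℕ) (a b : L n) : lineH n a b =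
    if a.1 = b.1 then (if (b.2 : ℕ) = a.2 + 1 ∨ (a.2 : ℕ) = b.2 + 1 then 1 else 0)
    else (if (a.2 : ℕ) = n ∧ (b.2 : ℕ) = n then √2 else 0) := rfl

/-- The reduced Hamiltonian is symmetric. [cite: ChildsEtAl2003, §3.3] -/
theorem lineH_symm (n : ℕ) (a b : L n) : lineH n a b = lineH n b a := by
  rw [lineH_apply, lineH_apply]
  by_cases h : a.1 = b.1
  · rw [if_pos h, if_pos h.symm]
    congr 1
    exact propext or_comm
  · rw [if_neg h, if_neg (Ne.symm h)]
    congr 1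
    exact propext and_comm

/-- The reduced Hamiltonian equals its transpose. [cite: ChildsEtAl2003, §3.3] -/
theorem lineH_transpose (n : ℕ) : (lineH n)ᵀ = lineH n := by
  ext a b; exact lineH_symm n b a

/-- The candidate eigenvector with sign `s` between the two sides and parameter `x`.
[cite: ChildsEtAl2003, §3.4] -/
def vec (n : ℕ) (s x : ℝ) : L n → ℝ := fun a => (if a.1 then s else 1) * u a.2 x

/-- The tridiagonal sum along one tree. [folklore] -/
theorem tri_sum (n : ℕ) (j : Fin (n + 1)) (f : ℕ → ℝ) :
    ∑ j' : Fin (n + 1), (if (j' : ℕ) = j + 1 ∨ (j : ℕ) = j' + 1 then (1 : ℝ) else 0) * f j' =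
      (if (j : ℕ) + 1 ≤ n then f (j + 1) else 0) + (if 1 ≤ (j : ℕ) then f (j - 1) else 0) := by
  have h1 : ∀ m : ℕ, (if m = j + 1 ∨ (j : ℕ) = m + 1 then (1 : ℝ) else 0) * f m =
      (if m = j + 1 then f m else 0) + (if m = j - 1 ∧ 1 ≤ (j : ℕ) then f m else 0) := by
    intro m
    by_cases hA : m = j + 1
    · have hB : ¬ (m = j - 1 ∧ 1 ≤ (j : ℕ)) := by omega
      rw [if_pos (Or.inl hA), if_pos hA, if_neg hB]; ring
    · by_cases hB : (j : ℕ) = m + 1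
      · have hB' : m = j - 1 ∧ 1 ≤ (j : ℕ) := by omega
        rw [if_pos (Or.inr hB), if_neg hA, if_pos hB']; ring
      · have hB' : ¬ (m = j - 1 ∧ 1 ≤ (j : ℕ)) := by omega
        rw [if_neg (by omega), if_neg hA, if_neg hB']; ring
  rw [Fin.sum_univ_eq_sum_range (fun m ↦ (if m = j + 1 ∨ (j : ℕ) = m + 1 then (1 : ℝ) else 0) * f m)
    (n + 1)]
  simp_rw [h1]
  rw [Finset.sum_add_distrib, Finset.sum_ite_eq']
  congr 1
  · simp only [Finset.mem_range]
    by_cases h : (j : ℕ) + 1 ≤ n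
    · rw [if_pos (by omega), if_pos h]
    · rw [if_neg (by omega), if_neg h]
  · by_cases h : 1 ≤ (j : ℕ)
    · simp_rw [and_iff_left h]
      rw [Finset.sum_ite_eq', if_pos h]
      simp only [Finset.mem_range]
      rw [if_pos (by omega)]
    · simp [h]

/-- The cross (glued) sum. [folklore] -/
theorem cross_sum (n : ℕ) (j : Fin (n + 1)) (f : ℕ → ℝ) :
    ∑ j' : Fin (n + 1), (if (j : ℕ) = n ∧ (j' : ℕ) = n then √2 else 0) * f j' =
      if (j : ℕ) = n then √2 * f n else 0 := by
  rw [Fin.sum_univ_eq_sum_range (fun m ↦ (if (j : ℕ) = n ∧ m = n then √2 else 0) * f m) (n + 1)]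
  by_cases h : (j : ℕ) = n
  · simp_rw [h, true_and, ite_mul, zero_mul]
    rw [Finset.sum_ite_eq']
    simp
  · simp [h]

/-- The three-term recursion in the bulk, with the boundary conventions. [folklore] -/
theorem u_tri (n : ℕ) (j : Fin (n + 1)) (x s : ℝ) (hx : u (n + 1) x = s * √2 * u n x) :
    (if (j : ℕ) + 1 ≤ n then u (j + 1) x else 0) + (if 1 ≤ (j : ℕ) then u (j - 1) x else 0) +
      (if (j : ℕ) = n then √2 * (s * u n x) else 0) = 2 * x * u j x := by
  have hj := j.2
  by_cases h1 : (j : ℕ) + 1 ≤ n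
  · rw [if_pos h1, if_neg (show ¬ ((j : ℕ) = n) by omega)]
    by_cases h2 : 1 ≤ (j : ℕ)
    · rw [if_pos h2]
      obtain ⟨m, hm⟩ : ∃ m, (j : ℕ) = m + 1 := ⟨j - 1, by omega⟩
      rw [hm, show m + 1 + 1 = m + 2 by ring, u_add_two, Nat.add_sub_cancel]; ring
    · rw [if_neg h2]
      have : (j : ℕ) = 0 := by omega
      rw [this]; simp
  · rw [if_neg h1]
    have hjn : (j : ℕ) = n := by omega
    rw [if_pos hjn]
    by_cases h2 : 1 ≤ (j : ℕ)
    · rw [if_pos h2, hjn]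
      obtain ⟨m, hm⟩ : ∃ m, n = m + 1 := ⟨n - 1, by omega⟩
      have hrec : u (n + 1) x = 2 * x * u n x - u (n - 1) x := by
        rw [hm, show m + 1 + 1 = m + 2 by ring, u_add_two, Nat.add_sub_cancel]
      have : √2 * (s * u n x) = u (n + 1) x := by rw [hx]; ring
      rw [this, hrec]; ring
    · rw [if_neg h2, hjn]
      have hn0 : n = 0 := by omega
      subst hn0
      have : √2 * (s * u 0 x) = u 1 x := by rw [hx]; ring
      rw [this]; simp

/-- `u_tri` scaled by a constant `a`. [folklore] -/
theorem u_tri' (n : ℕ) (j : Fin (n + 1)) (x s a : ℝ) (hx : u (n + 1) x = s * √2 * u n x) :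
    (if (j : ℕ) + 1 ≤ n then a * u (j + 1) x else 0) + (if 1 ≤ (j : ℕ) then a * u (j - 1) x else 0) +
      (if (j : ℕ) = n then √2 * (a * s * u n x) else 0) = 2 * x * (a * u j x) := by
  have h := u_tri n j x s hx
  split_ifs at h ⊢ <;> linear_combination a * h

/-- **Eigenvectors of the line.** If `u (n+1) x = s √2 u n x` and `s² = 1` then `vec n s x` is an
eigenvector of `lineH n` with eigenvalue `2x`. [cite: ChildsEtAl2003, §3.4] -/
theorem lineH_mulVec_vec (n : ℕ) {s x : ℝ} (hs : s * s = 1) (hx : u (n + 1) x = s * √2 * u n x) :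
    lineH n *ᵥ vec n s x = (2 * x) • vec n s x := by
  ext ⟨b, j⟩
  simp only [Matrix.mulVec, dotProduct, Fintype.sum_prod_type, Fintype.sum_bool, Pi.smul_apply,
    smul_eq_mul, lineH_apply, vec]
  cases b
  · simp only [Bool.false_eq_true, if_false, if_true, one_mul]
    rw [cross_sum n j (fun m ↦ s * u m x), tri_sum n j (fun m ↦ u m x), add_comm]
    exact u_tri n j x s hx
  · simp only [Bool.true_eq_false, Bool.false_eq_true, if_false, if_true, one_mul]
    rw [tri_sum n j (fun m ↦ s * u m x), cross_sum n j (fun m ↦ u m x),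
      show √2 * u n x = √2 * (s * s * u n x) by rw [hs, one_mul]]
    exact u_tri' n j x s s hx

/-- The candidate eigenvector has entry `1` at the ENTRANCE column. [cite: ChildsEtAl2003, §3.4] -/
theorem vec_entrance (n : ℕ) (s x : ℝ) : vec n s x (false, 0) = 1 := by simp [vec]

/-- The candidate eigenvector has entry `s` at the EXIT column (reflection parity: the EXIT
component is `±` the ENTRANCE component). [cite: ChildsEtAl2003, §3.4] -/
theorem vec_exit (n : ℕ) (s x : ℝ) : vec n s x (true, 0) = s := by simp [vec]

/-! ### P-IV. The explicit spectral decomposition of the line -/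

section spectral

variable (n : ℕ)

/-- Labels of the `2(n+1)` eigenvalues, by rank (decreasing). [folklore] -/
abbrev K (n : ℕ) : Type := Fin (2 * (n + 1))

/-- Half-eigenvalues `x_k` (the eigenvalue of `lineH` is `2 x_k`). [cite: ChildsEtAl2003, §3.4] -/
def xs (k : K n) : ℝ := g n k
/-- Parity signs `(-1)^k`. [cite: ChildsEtAl2003, §3.4] -/
def sg (k : K n) : ℝ := (-1) ^ (k : ℕ)
/-- The (unnormalised) eigenvectors. [cite: ChildsEtAl2003, §3.4] -/
def ev (k : K n) : L n → ℝ := vec n (sg n k) (xs n k)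
/-- Their squared norms. [folklore] -/
def nsq (k : K n) : ℝ := ev n k ⬝ᵥ ev n k

/-- Labels are `≤ 2n+1`. [folklore] -/
theorem K_le (k : K n) : (k : ℕ) ≤ 2 * n + 1 := by have := k.2; omega

/-- `s_k² = 1`. [folklore] -/
theorem sg_mul_self (k : K n) : sg n k * sg n k = 1 := by
  unfold sg; rw [← pow_add, ← two_mul, pow_mul]; norm_num

/-- `|s_k| = 1`. [folklore] -/
theorem abs_sg (k : K n) : |sg n k| = 1 := by
  unfold sg; rw [abs_pow, abs_neg, abs_one, one_pow]

variable {n}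

/-- `ev k` is an eigenvector of the line with eigenvalue `2 x_k`. [cite: ChildsEtAl2003, §3.4] -/
theorem lineH_mulVec_ev (hn : 8 ≤ n) (k : K n) : lineH n *ᵥ ev n k = (2 * xs n k) • ev n k :=
  lineH_mulVec_vec n (sg_mul_self n k) (u_match_g hn (K_le n k))

/-- `ev k` has entry `1` at the ENTRANCE column. [cite: ChildsEtAl2003, §3.4] -/
theorem ev_entrance (k : K n) : ev n k (false, 0) = 1 := vec_entrance _ _ _
/-- `ev k` has entry `s_k` at the EXIT column. [cite: ChildsEtAl2003, §3.4] -/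
theorem ev_exit (k : K n) : ev n k (true, 0) = sg n k := vec_exit _ _ _

/-- The eigenvectors are nonzero (`‖v_k‖² ≥ 1`). [folklore] -/
theorem nsq_pos (k : K n) : 0 < nsq n k := by
  unfold nsq dotProduct
  have h : (1 : ℝ) ≤ ∑ i : L n, ev n k i * ev n k i := by
    have := Finset.single_le_sum (f := fun i : L n ↦ ev n k i * ev n k i)
      (fun i _ ↦ mul_self_nonneg _) (Finset.mem_univ (false, 0))
    simpa [ev_entrance] using this
  linarith

/-- Distinct labels have half-eigenvalues at least `3/(n+1)³` apart (the spectral gap, Lemma 2 of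
the paper in bracketed form: `ΔE ≥ 6/(n+1)³`). [cite: ChildsEtAl2003, Lemma 2] -/
theorem xs_sep (hn : 8 ≤ n) {k k' : K n} (h : k ≠ k') : 3 / ((n : ℝ) + 1) ^ 3 ≤ |xs n k - xs n k'| :=
  g_sep hn (fun e ↦ h (Fin.ext e)) (K_le n k) (K_le n k')

/-- Distinct labels have distinct half-eigenvalues (simple spectrum). [cite: ChildsEtAl2003, Lemma
2] -/
theorem xs_ne (hn : 8 ≤ n) {k k' : K n} (h : k ≠ k') : xs n k ≠ xs n k' := by
  intro e
  have := xs_sep hn h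
  rw [e, sub_self, abs_zero] at this
  have : (0 : ℝ) < 3 / ((n : ℝ) + 1) ^ 3 := by positivity
  linarith

/-- Eigenvectors for distinct labels are orthogonal. [folklore] -/
theorem ev_orth (hn : 8 ≤ n) {k k' : K n} (h : k ≠ k') : ev n k ⬝ᵥ ev n k' = 0 := by
  have h1 : (2 * xs n k) * (ev n k ⬝ᵥ ev n k') = (2 * xs n k') * (ev n k ⬝ᵥ ev n k') := by
    calc (2 * xs n k) * (ev n k ⬝ᵥ ev n k') = ((2 * xs n k) • ev n k) ⬝ᵥ ev n k' := by
          rw [smul_dotProduct, smul_eq_mul]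
      _ = (lineH n *ᵥ ev n k) ⬝ᵥ ev n k' := by rw [lineH_mulVec_ev hn]
      _ = ev n k ⬝ᵥ (lineH n *ᵥ ev n k') := by
          rw [Matrix.dotProduct_mulVec, ← Matrix.mulVec_transpose, lineH_transpose]
      _ = (2 * xs n k') * (ev n k ⬝ᵥ ev n k') := by
          rw [lineH_mulVec_ev hn, dotProduct_smul, smul_eq_mul]
  have hne := xs_ne hn h
  have : (2 * xs n k - 2 * xs n k') * (ev n k ⬝ᵥ ev n k') = 0 := by linarith
  rcases mul_eq_zero.mp this with h0 | h0
  · exact absurd (by linarith : xs n k = xs n k') hne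
  · exact h0

/-- There are as many line sites as eigenvalue labels: `2(n+1)`. [folklore] -/
theorem card_L_eq : Fintype.card (L n) = Fintype.card (K n) := by
  simp [Fintype.card_prod, Fintype.card_bool, Fintype.card_fin]

/-- A fixed bijection between line sites and eigenvalue labels (to make `V` square). [folklore] -/
def eqv (n : ℕ) : L n ≃ K n := Fintype.equivOfCardEq card_L_eq

/-- The orthogonal matrix of normalised eigenvectors (columns, labelled through `eqv`).
[folklore] -/
def V (n : ℕ) : Matrix (L n) (L n) ℝ := Matrix.of fun a b ↦ ev n (eqv n b) a / √(nsq n (eqv n b))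

/-- Entries of `V`, unfolded. [folklore] -/
theorem V_apply (a b : L n) : V n a b = ev n (eqv n b) a / √(nsq n (eqv n b)) := rfl

/-- The normalised eigenvectors are orthonormal: `Vᵀ V = 1`. [folklore] -/
theorem Vt_mul_V (hn : 8 ≤ n) : (V n)ᵀ * V n = 1 := by
  ext b b'
  simp only [Matrix.mul_apply, Matrix.transpose_apply, V_apply, Matrix.one_apply]
  simp_rw [div_mul_div_comm, ← Finset.sum_div]
  have e : ∑ i : L n, ev n (eqv n b) i * ev n (eqv n b') i = ev n (eqv n b) ⬝ᵥ ev n (eqv n b') := rfl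
  rw [e]
  by_cases h : b = b'
  · subst h
    rw [if_pos rfl, Real.mul_self_sqrt (nsq_pos _).le]
    exact div_self (nsq_pos _).ne'
  · have h' : eqv n b ≠ eqv n b' := fun h'' ↦ h ((eqv n).injective h'')
    rw [if_neg h, ev_orth hn h', zero_div]

/-- Completeness: `V Vᵀ = 1` (a square matrix with a left inverse). [folklore] -/
theorem V_mul_Vt (hn : 8 ≤ n) : V n * (V n)ᵀ = 1 :=
  mul_eq_one_comm.mp (Vt_mul_V hn)

/-- `J V = V D` with `D = diag (2 x_k)`. [folklore] -/
theorem lineH_mul_V (hn : 8 ≤ n) :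
    lineH n * V n = V n * Matrix.diagonal (fun b ↦ 2 * xs n (eqv n b)) := by
  ext a b
  rw [Matrix.mul_diagonal, Matrix.mul_apply]
  simp only [V_apply]
  simp_rw [mul_div_assoc', ← Finset.sum_div]
  have e : ∑ b' : L n, lineH n a b' * ev n (eqv n b) b' = (lineH n *ᵥ ev n (eqv n b)) a := rfl
  rw [e, lineH_mulVec_ev hn, Pi.smul_apply, smul_eq_mul]
  ring

/-- The spectral decomposition `J = V D Vᵀ` of the reduced Hamiltonian. [cite: ChildsEtAl2003, §3.4]
-/
theorem lineH_eq_conj (hn : 8 ≤ n) :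
    lineH n = V n * Matrix.diagonal (fun b ↦ 2 * xs n (eqv n b)) * (V n)ᵀ := by
  rw [← lineH_mul_V hn, Matrix.mul_assoc, V_mul_Vt hn, Matrix.mul_one]

/-! Complexification and the exponential. -/

/-- The reduced Hamiltonian as a complex matrix. [cite: ChildsEtAl2003, §3.3] -/
def lineHC (n : ℕ) : Matrix (L n) (L n) ℂ := (lineH n).map (algebraMap ℝ ℂ)
/-- The complexified eigenvector matrix. [folklore] -/
def VC (n : ℕ) : Matrix (L n) (L n) ℂ := (V n).map (algebraMap ℝ ℂ)

/-- `V_ℂ V_ℂᵀ = 1`. [folklore] -/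
theorem VC_mul_VCt (hn : 8 ≤ n) : VC n * (VC n)ᵀ = 1 := by
  rw [VC, ← Matrix.transpose_map, ← Matrix.map_mul, V_mul_Vt hn,
    Matrix.map_one _ (map_zero _) (map_one _)]

/-- The spectral decomposition over `ℂ`: `J_ℂ = V_ℂ D_ℂ V_ℂᵀ`. [cite: ChildsEtAl2003, §3.4] -/
theorem lineHC_eq_conj (hn : 8 ≤ n) :
    lineHC n = VC n * Matrix.diagonal (fun b ↦ ((2 * xs n (eqv n b) : ℝ) : ℂ)) * (VC n)ᵀ := by
  rw [lineHC, lineH_eq_conj hn, Matrix.map_mul, Matrix.map_mul, VC, Matrix.transpose_map,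
    Matrix.diagonal_map (map_zero _)]
  rfl

open NormedSpace in
/-- **Spectral formula for the walk on the line.** [cite: ChildsEtAl2003, §3.4] -/
theorem exp_smul_lineHC (hn : 8 ≤ n) (c : ℂ) :
    exp (c • lineHC n) =
      VC n * Matrix.diagonal (fun b ↦ Complex.exp (c * (2 * xs n (eqv n b)))) * (VC n)ᵀ := by
  have hinv : (VC n)⁻¹ = (VC n)ᵀ := Matrix.inv_eq_right_inv (VC_mul_VCt hn)
  have hunit : IsUnit (VC n) := IsUnit.of_mul_eq_one _ (VC_mul_VCt hn)
  have e1 : c • lineHC n =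
      VC n * Matrix.diagonal (fun b ↦ c * (2 * xs n (eqv n b))) * (VC n)⁻¹ := by
    rw [hinv, lineHC_eq_conj hn, ← Matrix.smul_mul, ← Matrix.mul_smul]
    congr 2
    ext i j
    rw [Matrix.smul_apply, Matrix.diagonal_apply, Matrix.diagonal_apply, smul_eq_mul]
    split_ifs
    · push_cast; ring
    · simp
  rw [e1, Matrix.exp_conj _ _ hunit, Matrix.exp_diagonal, hinv, Pi.exp_def]
  congr 2
  ext b
  rw [Complex.exp_eq_exp_ℂ]

/-- The coefficients `c_k = s_k / ‖v_k‖²` of the EXIT amplitude. [cite: ChildsEtAl2003, §3.4] -/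
def coef (n : ℕ) (k : K n) : ℝ := sg n k / nsq n k

open NormedSpace in
/-- The EXIT–ENTRANCE entry of the walk on the line: `Σ_k c_k e^{c·2x_k}`.
[cite: ChildsEtAl2003, §3.4] -/
theorem exp_smul_lineHC_exit_entrance (hn : 8 ≤ n) (c : ℂ) :
    exp (c • lineHC n) (true, 0) (false, 0) =
      ∑ k : K n, (coef n k : ℂ) * Complex.exp (c * (2 * xs n k)) := by
  rw [exp_smul_lineHC hn, Matrix.mul_apply,
    ← (eqv n).sum_comp (fun k ↦ (coef n k : ℂ) * Complex.exp (c * (2 * xs n k)))]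
  refine Finset.sum_congr rfl fun b _ ↦ ?_
  rw [Matrix.mul_diagonal, Matrix.transpose_apply]
  simp only [VC, Matrix.map_apply, V_apply, ev_exit, ev_entrance, coef]
  have hpos := nsq_pos (n := n) (eqv n b)
  have e : sg n (eqv n b) / nsq n (eqv n b) =
      sg n (eqv n b) / √(nsq n (eqv n b)) * (1 / √(nsq n (eqv n b))) := by
    rw [div_mul_div_comm, mul_one, Real.mul_self_sqrt hpos.le]
  rw [e]
  simp only [Complex.coe_algebraMap]
  push_cast
  ring

/-- `|c_k| = 1/‖v_k‖²`. [cite: ChildsEtAl2003, §3.4] -/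
theorem abs_coef (k : K n) : |coef n k| = 1 / nsq n k := by
  rw [coef, abs_div, abs_sg, abs_of_pos (nsq_pos k)]

/-- `Σ_k 1/‖v_k‖² = 1` (the ENTRANCE row of `V Vᵀ = 1`), i.e. the ENTRANCE overlaps `|⟨E|col 1⟩|²`
sum to `1`. [cite: ChildsEtAl2003, §3.4] -/
theorem sum_inv_nsq (hn : 8 ≤ n) : ∑ k : K n, 1 / nsq n k = 1 := by
  have h := congrFun (congrFun (V_mul_Vt hn) (false, 0)) (false, 0)
  rw [Matrix.mul_apply, Matrix.one_apply_eq] at h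
  rw [← (eqv n).sum_comp (fun k ↦ 1 / nsq n k)]
  refine Eq.trans (Finset.sum_congr rfl fun b _ ↦ ?_) h
  rw [Matrix.transpose_apply, V_apply, ev_entrance, div_mul_div_comm, one_mul,
    Real.mul_self_sqrt (nsq_pos _).le]

/-- `Σ_k |c_k| = 1`. [cite: ChildsEtAl2003, §3.4] -/
theorem sum_abs_coef (hn : 8 ≤ n) : ∑ k : K n, |coef n k| = 1 := by
  simp_rw [abs_coef]; exact sum_inv_nsq hn

/-- Cauchy–Schwarz: `Σ_k c_k² ≥ 1/(2(n+1))`. [cite: ChildsEtAl2003, Lemma 1] -/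
theorem sum_coef_sq (hn : 8 ≤ n) : 1 / (2 * ((n : ℝ) + 1)) ≤ ∑ k : K n, coef n k ^ 2 := by
  have hcs := sq_sum_le_card_mul_sum_sq (s := (Finset.univ : Finset (K n))) (f := fun k ↦ |coef n k|)
  rw [sum_abs_coef hn, one_pow, Finset.card_univ, Fintype.card_fin] at hcs
  simp_rw [sq_abs] at hcs
  rw [div_le_iff₀ (by positivity)]
  calc (1 : ℝ) ≤ ((2 * (n + 1) : ℕ) : ℝ) * ∑ k : K n, coef n k ^ 2 := hcs
    _ = (∑ k : K n, coef n k ^ 2) * (2 * ((n : ℝ) + 1)) := by push_cast; ring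

end spectral

/-! ### P-VI. Time averages of finite exponential sums (Lemma 1 of the paper, real form) -/

section average

variable {ι : Type*} [Fintype ι]

/-- `‖Σ_k c_k e^{-i t E_k}‖² = Σ_k Σ_k' c_k c_k' cos (t (E_k - E_k'))` for real `c, E`.
[folklore] -/
theorem norm_sq_sum_exp (c E : ι → ℝ) (t : ℝ) :
    ‖∑ k, (c k : ℂ) * Complex.exp ((-(t * E k) : ℝ) * Complex.I)‖ ^ 2 =
      ∑ k, ∑ k', c k * c k' * Real.cos (t * (E k - E k')) := by
  rw [Complex.sq_norm, Complex.normSq_apply, Complex.re_sum, Complex.im_sum]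
  simp only [Complex.mul_re, Complex.mul_im, Complex.ofReal_re, Complex.ofReal_im,
    Complex.exp_ofReal_mul_I_re, Complex.exp_ofReal_mul_I_im, zero_mul, sub_zero, add_zero]
  rw [Finset.sum_mul_sum, Finset.sum_mul_sum, ← Finset.sum_add_distrib]
  refine Finset.sum_congr rfl fun k _ ↦ ?_
  rw [← Finset.sum_add_distrib]
  refine Finset.sum_congr rfl fun k' _ ↦ ?_
  rw [show t * (E k - E k') = (-(t * E k')) - (-(t * E k)) by ring, Real.cos_sub]
  ring

/-- `∫₀^τ cos (t ω) dt = sin (τ ω)/ω` for `ω ≠ 0`. [folklore] -/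
theorem integral_cos_mul {ω : ℝ} (hω : ω ≠ 0) (τ : ℝ) :
    ∫ t in (0:ℝ)..τ, Real.cos (t * ω) = Real.sin (τ * ω) / ω := by
  have hd : ∀ t, HasDerivAt (fun t ↦ Real.sin (t * ω) / ω) (Real.cos (t * ω)) t := by
    intro t
    have h := (((hasDerivAt_id t).mul_const ω).sin).div_const ω
    have e : Real.cos (id t * ω) * (1 * ω) / ω = Real.cos (t * ω) := by
      simp only [id, one_mul]; field_simp
    rw [e] at h
    exact h
  rw [intervalIntegral.integral_eq_sub_of_hasDerivAt (fun t _ ↦ hd t)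
    ((by fun_prop : Continuous fun t ↦ Real.cos (t * ω)).intervalIntegrable _ _)]
  simp

/-- `|∫₀^τ cos (t ω) dt| ≤ 1/|ω|` for `ω ≠ 0`. [folklore] -/
theorem abs_integral_cos_mul_le {ω : ℝ} (hω : ω ≠ 0) (τ : ℝ) :
    |∫ t in (0:ℝ)..τ, Real.cos (t * ω)| ≤ 1 / |ω| := by
  rw [integral_cos_mul hω, abs_div]
  exact div_le_div_of_nonneg_right (Real.abs_sin_le_one _) (abs_pos.mpr hω).le

/-- **Lower bound for the time average** (the real-form version of Lemma 1 of the paper):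
`∫₀^τ ‖Σ_k c_k e^{-itE_k}‖² ≥ τ Σ_k c_k² - (Σ_k |c_k|)² / δ` when distinct `E_k` are `δ`-separated.
[cite: ChildsEtAl2003, Lemma 1] -/
theorem integral_norm_sq_lower [DecidableEq ι] (c E : ι → ℝ) {δ : ℝ} (τ : ℝ) (hδ : 0 < δ)
    (hsep : ∀ k k', k ≠ k' → δ ≤ |E k - E k'|) :
    τ * ∑ k, c k ^ 2 - (∑ k, |c k|) ^ 2 / δ ≤
      ∫ t in (0:ℝ)..τ, ‖∑ k, (c k : ℂ) * Complex.exp ((-(t * E k) : ℝ) * Complex.I)‖ ^ 2 := by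
  simp_rw [norm_sq_sum_exp]
  have hint : ∀ k k', IntervalIntegrable (fun t ↦ c k * c k' * Real.cos (t * (E k - E k')))
      MeasureTheory.volume 0 τ :=
    fun k k' ↦ (by fun_prop : Continuous fun t ↦ c k * c k' * Real.cos (t * (E k - E k'))).intervalIntegrable _ _
  have hint' : ∀ k, IntervalIntegrable (fun t ↦ ∑ k', c k * c k' * Real.cos (t * (E k - E k')))
      MeasureTheory.volume 0 τ :=
    fun k ↦ (continuous_finsetSum _ (fun k' _ ↦
      (by fun_prop : Continuous fun t ↦ c k * c k' * Real.cos (t * (E k - E k'))))).intervalIntegrable _ _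
  rw [intervalIntegral.integral_finsetSum (fun k _ ↦ hint' k)]
  rw [Finset.sum_congr rfl (fun k _ ↦ intervalIntegral.integral_finsetSum (fun k' _ ↦ hint k k'))]
  -- termwise lower bounds
  have hterm : ∀ k k', (if k = k' then τ * c k ^ 2 else -(|c k| * |c k'| / δ)) ≤
      ∫ t in (0:ℝ)..τ, c k * c k' * Real.cos (t * (E k - E k')) := by
    intro k k'
    by_cases h : k = k'
    · subst h
      rw [if_pos rfl]
      simp only [sub_self, mul_zero, Real.cos_zero, mul_one, intervalIntegral.integral_const,
        smul_eq_mul]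
      nlinarith
    · rw [if_neg h, intervalIntegral.integral_const_mul]
      have hω : E k - E k' ≠ 0 := by
        intro e
        have := hsep k k' h
        rw [e, abs_zero] at this
        linarith
      have hb := abs_integral_cos_mul_le hω τ
      have h1 : |c k * c k' * ∫ t in (0:ℝ)..τ, Real.cos (t * (E k - E k'))| ≤ |c k| * |c k'| / δ := by
        rw [abs_mul, abs_mul]
        calc |c k| * |c k'| * |∫ t in (0:ℝ)..τ, Real.cos (t * (E k - E k'))|
            ≤ |c k| * |c k'| * (1 / |E k - E k'|) :=
              mul_le_mul_of_nonneg_left hb (by positivity)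
          _ ≤ |c k| * |c k'| * (1 / δ) := by
              apply mul_le_mul_of_nonneg_left _ (by positivity)
              exact one_div_le_one_div_of_le hδ (hsep k k' h)
          _ = |c k| * |c k'| / δ := by ring
      linarith [neg_abs_le (c k * c k' * ∫ t in (0:ℝ)..τ, Real.cos (t * (E k - E k')))]
  -- summing the lower bounds
  have hsum : τ * ∑ k, c k ^ 2 - (∑ k, |c k|) ^ 2 / δ ≤
      ∑ k, ∑ k', (if k = k' then τ * c k ^ 2 else -(|c k| * |c k'| / δ)) := by
    have e : ∀ k, ∑ k', (if k = k' then τ * c k ^ 2 else -(|c k| * |c k'| / δ)) =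
        τ * c k ^ 2 - ∑ k' ∈ Finset.univ.erase k, |c k| * |c k'| / δ := by
      intro k
      rw [← Finset.add_sum_erase _ _ (Finset.mem_univ k), if_pos rfl, sub_eq_add_neg,
        ← Finset.sum_neg_distrib]
      congr 1
      exact Finset.sum_congr rfl fun k' hk' ↦ if_neg (Finset.ne_of_mem_erase hk').symm
    simp_rw [e]
    rw [Finset.sum_sub_distrib, ← Finset.mul_sum, sq, Finset.sum_mul_sum, Finset.sum_div]
    gcongr with k _
    rw [Finset.sum_div]
    apply Finset.sum_le_univ_sum_of_nonneg
    intro k'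
    positivity
  exact hsum.trans (Finset.sum_le_sum fun k _ ↦ Finset.sum_le_sum fun k' _ ↦ hterm k k')

end average

/-! ### P-V. The column-space reduction (§3.3 of the paper) -/

section column

variable {n : ℕ}

/-- The column of a vertex: (side, depth). [cite: ChildsEtAl2003, §3.3] -/
def col (v : Vertex n) : L n := (v.1, v.2.1)

/-- The side of a column. [cite: ChildsEtAl2003, §3.3] -/
@[simp] theorem col_fst (v : Vertex n) : (col v).1 = v.1 := rfl
/-- The depth of a column. [cite: ChildsEtAl2003, §3.3] -/
@[simp] theorem col_snd (v : Vertex n) : (col v).2 = v.2.1 := rfl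

/-- A vertex lies in column `c` iff its side and depth are those of `c`. [cite: ChildsEtAl2003,
§3.3] -/
theorem col_eq_iff (v : Vertex n) (c : L n) : col v = c ↔ v.1 = c.1 ∧ v.2.1 = c.2 := by
  obtain ⟨b, j⟩ := c; simp [col, Prod.ext_iff]

/-- Equality of vertices in coordinates. [folklore] -/
theorem vertex_ext_iff (u w : Vertex n) :
    u = w ↔ u.1 = w.1 ∧ (u.2.1 : ℕ) = w.2.1 ∧ (u.2.2 : ℕ) = w.2.2 := by
  constructor
  · rintro rfl; exact ⟨rfl, rfl, rfl⟩
  · obtain ⟨b, j, i⟩ := u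
    obtain ⟨b', j', i'⟩ := w
    rintro ⟨h1, h2, h3⟩
    simp only at h1 h2 h3
    subst h1
    obtain rfl : j = j' := Fin.ext h2
    obtain rfl : i = i' := Fin.ext h3
    rfl

/-- Distinct indices give distinct left leaves. [cite: ChildsEtAl2003, §2] -/
theorem leafL_injective : Function.Injective (leafL n) := by
  intro a b h
  have := ((vertex_ext_iff _ _).mp h).2.2
  exact Fin.ext this

/-- Distinct indices give distinct right leaves. [cite: ChildsEtAl2003, §2] -/
theorem leafR_injective : Function.Injective (leafR n) := by
  intro a b h
  have := ((vertex_ext_iff _ _).mp h).2.2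
  exact Fin.ext this

/-- A left leaf is not a right leaf. [cite: ChildsEtAl2003, §2] -/
theorem leafL_ne_leafR (a b : Fin (2 ^ n)) : leafL n a ≠ leafR n b := by
  intro h
  have := ((vertex_ext_iff _ _).mp h).1
  simp [leafL, leafR] at this

/-- A vertex of depth `n` on the left is a left leaf. [cite: ChildsEtAl2003, §2] -/
theorem exists_eq_leafL {v : Vertex n} (hb : v.1 = false) (hj : (v.2.1 : ℕ) = n) :
    ∃ i, v = leafL n i := by
  obtain ⟨b, j, i⟩ := v
  simp only at hb hj
  subst hb
  obtain rfl : j = Fin.last n := Fin.ext hj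
  exact ⟨i, rfl⟩

/-- A vertex of depth `n` on the right is a right leaf. [cite: ChildsEtAl2003, §2] -/
theorem exists_eq_leafR {v : Vertex n} (hb : v.1 = true) (hj : (v.2.1 : ℕ) = n) :
    ∃ i, v = leafR n i := by
  obtain ⟨b, j, i⟩ := v
  simp only at hb hj
  subst hb
  obtain rfl : j = Fin.last n := Fin.ext hj
  exact ⟨i, rfl⟩

/-- Case analysis of a cycle edge: `e k → f k` or `f k → e (k+1)`. [cite: ChildsEtAl2003, §2] -/
theorem isGlued_cases {σ : CycleDatum n} {u v : Vertex n} (h : IsGlued σ u v) :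
    (∃ k, u = leafL n (σ.1 k) ∧ v = leafR n (σ.2 k)) ∨
      (∃ k, u = leafR n (σ.2 k) ∧ v = leafL n (σ.1 (finRotate _ k))) := by
  obtain ⟨k, h | h⟩ := h
  exacts [Or.inl ⟨k, h⟩, Or.inr ⟨k, h⟩]

/-- Cycle edges join the two sides. [cite: ChildsEtAl2003, §2] -/
theorem isGlued_fst_ne {σ : CycleDatum n} {u v : Vertex n} (h : IsGlued σ u v) : u.1 ≠ v.1 := by
  rcases isGlued_cases h with ⟨k, rfl, rfl⟩ | ⟨k, rfl, rfl⟩ <;> simp [leafL, leafR]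

/-- Cycle edges start at depth `n`. [cite: ChildsEtAl2003, §2] -/
theorem isGlued_depth_left {σ : CycleDatum n} {u v : Vertex n} (h : IsGlued σ u v) :
    (u.2.1 : ℕ) = n := by
  rcases isGlued_cases h with ⟨k, rfl, rfl⟩ | ⟨k, rfl, rfl⟩ <;> rfl

/-- Cycle edges end at depth `n`. [cite: ChildsEtAl2003, §2] -/
theorem isGlued_depth_right {σ : CycleDatum n} {u v : Vertex n} (h : IsGlued σ u v) :
    (v.2.1 : ℕ) = n := by
  rcases isGlued_cases h with ⟨k, rfl, rfl⟩ | ⟨k, rfl, rfl⟩ <;> rfl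

/-- The directed cycle edge out of the left leaf `i` goes to the right leaf `f (e.symm i)`. [cite:
ChildsEtAl2003, §2] -/
theorem isGlued_leafL_leafR_iff (σ : CycleDatum n) (i i' : Fin (2 ^ n)) :
    IsGlued σ (leafL n i) (leafR n i') ↔ i' = σ.2 (σ.1.symm i) := by
  constructor
  · rintro ⟨k, ⟨h1, h2⟩ | ⟨h1, -⟩⟩
    · rw [leafL_injective.eq_iff] at h1
      rw [leafR_injective.eq_iff] at h2
      rw [h2, h1, Equiv.symm_apply_apply]
    · exact absurd h1 (leafL_ne_leafR _ _)
  · rintro rfl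
    exact ⟨σ.1.symm i, Or.inl ⟨by simp, rfl⟩⟩

/-- The directed cycle edge out of the right leaf `i` goes to the left leaf `e (rot (f.symm i))`.
[cite: ChildsEtAl2003, §2] -/
theorem isGlued_leafR_leafL_iff (σ : CycleDatum n) (i' i : Fin (2 ^ n)) :
    IsGlued σ (leafR n i') (leafL n i) ↔ i = σ.1 (finRotate _ (σ.2.symm i')) := by
  constructor
  · rintro ⟨k, ⟨h1, -⟩ | ⟨h1, h2⟩⟩
    · exact absurd h1.symm (leafL_ne_leafR _ _)
    · rw [leafR_injective.eq_iff] at h1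
      rw [leafL_injective.eq_iff] at h2
      rw [h2, h1, Equiv.symm_apply_apply]
  · rintro rfl
    exact ⟨σ.2.symm i', Or.inr ⟨by simp, rfl⟩⟩

/-- The alternating cycle never glues a leaf twice to the same partner: `finRotate (2^n)` has no
fixed point for `n ≥ 1` (the degenerate case `n = 0` is excluded). [cite: ChildsEtAl2003, §2] -/
theorem finRotate_two_pow_apply_ne (hn : 1 ≤ n) (k : Fin (2 ^ n)) : finRotate (2 ^ n) k ≠ k := by
  have h2 : 2 ≤ 2 ^ n := by
    calc 2 = 2 ^ 1 := by norm_num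
      _ ≤ 2 ^ n := Nat.pow_le_pow_right (by norm_num) hn
  obtain ⟨m, hm⟩ : ∃ m', 2 ^ n = m' + 1 := ⟨2 ^ n - 1, by omega⟩
  revert k
  rw [hm]
  intro k h
  rw [finRotate_apply] at h
  have h1 : (1 : Fin (m + 1)) = 0 := by simpa using h
  rw [Fin.one_eq_zero_iff] at h1
  omega

/-- The neighbours of `v` lying in column `c`. [cite: ChildsEtAl2003, §3.3] -/
def S (σ : CycleDatum n) (v : Vertex n) (c : L n) : Finset (Vertex n) :=
  Finset.univ.filter (fun u ↦ (graph n σ).Adj v u ∧ col u = c)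

/-- Membership in `S σ v c`: adjacency to `v` and lying in column `c`. [cite: ChildsEtAl2003, §3.3]
-/
theorem mem_S {σ : CycleDatum n} {v : Vertex n} {c : L n} {u : Vertex n} :
    u ∈ S σ v c ↔ (graph n σ).Adj v u ∧ col u = c := by
  simp [S]

/-- (C1) The two children. [cite: ChildsEtAl2003, §2] -/
theorem S_children (σ : CycleDatum n) (v : Vertex n) (j' : Fin (n + 1))
    (hj : (j' : ℕ) = v.2.1 + 1) : (S σ v (v.1, j')).card = 2 := by
  have hi := v.2.2.2
  have hpow : 2 ^ (j' : ℕ) = 2 * 2 ^ (v.2.1 : ℕ) := by rw [hj, pow_succ]; ring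
  set u₁ : Vertex n := (v.1, ⟨j', ⟨2 * v.2.2, by rw [hpow]; omega⟩⟩) with hu₁
  set u₂ : Vertex n := (v.1, ⟨j', ⟨2 * v.2.2 + 1, by rw [hpow]; omega⟩⟩) with hu₂
  have hne : u₁ ≠ u₂ := by
    intro h; have := ((vertex_ext_iff _ _).mp h).2.2; simp [u₁, u₂] at this
  have hS : S σ v (v.1, j') = {u₁, u₂} := by
    ext u
    rw [mem_S, Finset.mem_insert, Finset.mem_singleton, graph_adj, col_eq_iff]
    constructor
    · rintro ⟨⟨-, (h | h) | (h | h)⟩, hb, hj'⟩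
      · have := h.2.1; simp only at this hb hj'; rw [hj'] at this; omega
      · exact absurd hb.symm (isGlued_fst_ne h)
      · have h3 := h.2.2
        simp only at hb hj' h3
        have : (u.2.2 : ℕ) = 2 * v.2.2 ∨ (u.2.2 : ℕ) = 2 * v.2.2 + 1 := by omega
        rcases this with h4 | h4
        · left; rw [vertex_ext_iff]; exact ⟨hb, by rw [hj'], by simpa [u₁] using h4⟩
        · right; rw [vertex_ext_iff]; exact ⟨hb, by rw [hj'], by simpa [u₂] using h4⟩
      · exact absurd hb (isGlued_fst_ne h)
    · rintro (rfl | rfl)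
      · refine ⟨⟨?_, Or.inr (Or.inl ⟨rfl, by simp [u₁, hj], by simp [u₁]⟩)⟩, rfl, rfl⟩
        intro h; have := ((vertex_ext_iff _ _).mp h).2.1; simp [u₁] at this; omega
      · refine ⟨⟨?_, Or.inr (Or.inl ⟨rfl, by simp [u₂, hj], by simp [u₂]; omega⟩)⟩, rfl, rfl⟩
        intro h; have := ((vertex_ext_iff _ _).mp h).2.1; simp [u₂] at this; omega
  rw [hS, Finset.card_pair hne]

/-- (C2) The parent. [cite: ChildsEtAl2003, §2] -/
theorem S_parent (σ : CycleDatum n) (v : Vertex n) (j' : Fin (n + 1))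
    (hj : (v.2.1 : ℕ) = j' + 1) : (S σ v (v.1, j')).card = 1 := by
  have hi := v.2.2.2
  have hpow : 2 ^ (v.2.1 : ℕ) = 2 * 2 ^ (j' : ℕ) := by rw [hj, pow_succ]; ring
  have hi' : (v.2.2 : ℕ) < 2 * 2 ^ (j' : ℕ) := lt_of_lt_of_eq hi hpow
  set u₀ : Vertex n := (v.1, ⟨j', ⟨v.2.2 / 2, by omega⟩⟩) with hu₀
  have hS : S σ v (v.1, j') = {u₀} := by
    ext u
    rw [mem_S, Finset.mem_singleton, graph_adj, col_eq_iff]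
    constructor
    · rintro ⟨⟨-, (h | h) | (h | h)⟩, hb, hj'⟩
      · have h3 := h.2.2
        rw [vertex_ext_iff]; exact ⟨hb, by rw [hj'], by simpa [u₀] using h3.symm⟩
      · exact absurd hb.symm (isGlued_fst_ne h)
      · have := h.2.1; simp only at this hb hj'; rw [hj'] at this; omega
      · exact absurd hb (isGlued_fst_ne h)
    · rintro rfl
      refine ⟨⟨?_, Or.inl (Or.inl ⟨rfl, by simp [u₀, hj], by simp [u₀]⟩)⟩, rfl, rfl⟩
      intro h; have := ((vertex_ext_iff _ _).mp h).2.1; simp [u₀] at this; omega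
  rw [hS, Finset.card_singleton]

/-- (C3) No other neighbours on the same side. [cite: ChildsEtAl2003, §2] -/
theorem S_same_side_other (σ : CycleDatum n) (v : Vertex n) (j' : Fin (n + 1))
    (h1 : ¬ (j' : ℕ) = v.2.1 + 1) (h2 : ¬ (v.2.1 : ℕ) = j' + 1) : (S σ v (v.1, j')).card = 0 := by
  rw [Finset.card_eq_zero, Finset.eq_empty_iff_forall_notMem]
  intro u hu
  rw [mem_S, graph_adj, col_eq_iff] at hu
  obtain ⟨⟨-, (h | h) | (h | h)⟩, hb, hj'⟩ := hu
  · have := h.2.1; simp only at this hj'; rw [hj'] at this; exact h2 this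
  · exact absurd hb.symm (isGlued_fst_ne h)
  · have := h.2.1; simp only at this hj'; rw [hj'] at this; exact h1 this
  · exact absurd hb (isGlued_fst_ne h)

/-- (C5) No cross neighbours away from the leaves. [cite: ChildsEtAl2003, §2] -/
theorem S_cross_other (σ : CycleDatum n) (v : Vertex n) (c : L n) (hb : c.1 ≠ v.1)
    (h : ¬ ((v.2.1 : ℕ) = n ∧ (c.2 : ℕ) = n)) : (S σ v c).card = 0 := by
  rw [Finset.card_eq_zero, Finset.eq_empty_iff_forall_notMem]
  intro u hu
  rw [mem_S, graph_adj, col_eq_iff] at hu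
  obtain ⟨⟨-, (h' | h') | (h' | h')⟩, hb', hj'⟩ := hu
  · exact hb (by rw [← hb', h'.1])
  · exact h ⟨isGlued_depth_left h', by rw [← hj']; exact isGlued_depth_right h'⟩
  · exact hb (by rw [← hb', h'.1])
  · exact h ⟨isGlued_depth_right h', by rw [← hj']; exact isGlued_depth_left h'⟩

/-- (C4) The two glued partners of a left leaf. [cite: ChildsEtAl2003, §2] -/
theorem S_glued_left (hn : 1 ≤ n) (σ : CycleDatum n) (i : Fin (2 ^ n)) :
    (S σ (leafL n i) (true, Fin.last n)).card = 2 := by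
  set a : Fin (2 ^ n) := σ.2 (σ.1.symm i) with ha
  set b : Fin (2 ^ n) := σ.2 ((finRotate _).symm (σ.1.symm i)) with hb
  have hne : leafR n a ≠ leafR n b := by
    intro h
    have h1 := σ.2.injective (leafR_injective h)
    have h2 := finRotate_two_pow_apply_ne hn ((finRotate _).symm (σ.1.symm i))
    rw [Equiv.apply_symm_apply] at h2
    exact h2 h1
  have hS : S σ (leafL n i) (true, Fin.last n) = {leafR n a, leafR n b} := by
    ext u
    rw [mem_S, Finset.mem_insert, Finset.mem_singleton, graph_adj, col_eq_iff]
    constructor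
    · rintro ⟨⟨-, hadj⟩, hb', hj'⟩
      obtain ⟨i', rfl⟩ := exists_eq_leafR hb' (by rw [hj']; rfl)
      rcases hadj with (h | h) | (h | h)
      · exact absurd h.1 (by simp [leafL, leafR])
      · left; rw [(isGlued_leafL_leafR_iff σ i i').mp h]
      · exact absurd h.1 (by simp [leafL, leafR])
      · right
        have h' := (isGlued_leafR_leafL_iff σ i' i).mp h
        rw [hb, show σ.1.symm i = finRotate _ (σ.2.symm i') by rw [h', Equiv.symm_apply_apply],
          Equiv.symm_apply_apply, Equiv.apply_symm_apply]
    · rintro (rfl | rfl)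
      · refine ⟨⟨leafL_ne_leafR _ _, Or.inl (Or.inr ((isGlued_leafL_leafR_iff σ i a).mpr ha))⟩,
          rfl, rfl⟩
      · refine ⟨⟨leafL_ne_leafR _ _, Or.inr (Or.inr ((isGlued_leafR_leafL_iff σ b i).mpr ?_))⟩,
          rfl, rfl⟩
        rw [hb, Equiv.symm_apply_apply, Equiv.apply_symm_apply, Equiv.apply_symm_apply]
  rw [hS, Finset.card_pair hne]

/-- (C4') The two glued partners of a right leaf. [cite: ChildsEtAl2003, §2] -/
theorem S_glued_right (hn : 1 ≤ n) (σ : CycleDatum n) (i' : Fin (2 ^ n)) :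
    (S σ (leafR n i') (false, Fin.last n)).card = 2 := by
  set a : Fin (2 ^ n) := σ.1 (finRotate _ (σ.2.symm i')) with ha
  set b : Fin (2 ^ n) := σ.1 (σ.2.symm i') with hb
  have hne : leafL n a ≠ leafL n b := by
    intro h
    have h1 := σ.1.injective (leafL_injective h)
    exact finRotate_two_pow_apply_ne hn _ h1
  have hS : S σ (leafR n i') (false, Fin.last n) = {leafL n a, leafL n b} := by
    ext u
    rw [mem_S, Finset.mem_insert, Finset.mem_singleton, graph_adj, col_eq_iff]
    constructor
    · rintro ⟨⟨-, hadj⟩, hb', hj'⟩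
      obtain ⟨i, rfl⟩ := exists_eq_leafL hb' (by rw [hj']; rfl)
      rcases hadj with (h | h) | (h | h)
      · exact absurd h.1 (by simp [leafL, leafR])
      · left; rw [(isGlued_leafR_leafL_iff σ i' i).mp h]
      · exact absurd h.1 (by simp [leafL, leafR])
      · right
        rw [hb, (isGlued_leafL_leafR_iff σ i i').mp h, Equiv.symm_apply_apply, Equiv.apply_symm_apply]
    · rintro (rfl | rfl)
      · exact ⟨⟨(leafL_ne_leafR _ _).symm, Or.inl (Or.inr ((isGlued_leafR_leafL_iff σ i' a).mpr ha))⟩,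
          rfl, rfl⟩
      · refine ⟨⟨(leafL_ne_leafR _ _).symm, Or.inr (Or.inr ((isGlued_leafL_leafR_iff σ b i').mpr ?_))⟩,
          rfl, rfl⟩
        rw [hb, Equiv.symm_apply_apply, Equiv.apply_symm_apply]
  rw [hS, Finset.card_pair hne]

/-- The master count of neighbours of `v` in column `c` (for `n ≥ 1`).
[cite: ChildsEtAl2003, §3.3] -/
theorem card_S (hn : 1 ≤ n) (σ : CycleDatum n) (v : Vertex n) (c : L n) :
    ((S σ v c).card : ℝ) =
      if v.1 = c.1 then
        (if (c.2 : ℕ) = v.2.1 + 1 then 2 else if (v.2.1 : ℕ) = c.2 + 1 then 1 else 0)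
      else (if (v.2.1 : ℕ) = n ∧ (c.2 : ℕ) = n then 2 else 0) := by
  obtain ⟨b', j'⟩ := c
  by_cases hb : v.1 = b'
  · rw [if_pos hb]
    simp only
    subst hb
    by_cases h1 : (j' : ℕ) = v.2.1 + 1
    · rw [if_pos h1, S_children σ v j' h1]; norm_num
    · rw [if_neg h1]
      by_cases h2 : (v.2.1 : ℕ) = j' + 1
      · rw [if_pos h2, S_parent σ v j' h2]; norm_num
      · rw [if_neg h2, S_same_side_other σ v j' h1 h2]; norm_num
  · rw [if_neg hb]
    simp only
    by_cases h : (v.2.1 : ℕ) = n ∧ (j' : ℕ) = n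
    · rw [if_pos h]
      obtain rfl : j' = Fin.last n := Fin.ext h.2
      cases hv : v.1
      · obtain ⟨i, rfl⟩ := exists_eq_leafL hv h.1
        have hb' : b' = true := by
          cases b'
          · exact absurd hv.symm (by simpa using hb)
          · rfl
        subst hb'
        rw [S_glued_left hn σ i]; norm_num
      · obtain ⟨i, rfl⟩ := exists_eq_leafR hv h.1
        have hb' : b' = false := by
          cases b'
          · rfl
          · exact absurd hv.symm (by simpa using hb)
        subst hb'
        rw [S_glued_right hn σ i]; norm_num
    · rw [if_neg h, S_cross_other σ v (b', j') (Ne.symm hb) h]; norm_num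

/-- Column weights `(√2)^{-j}` (`= 1/√N_j` with `N_j = 2^j` vertices in a column of depth `j`).
[cite: ChildsEtAl2003, §3.3] -/
def wt (j : ℕ) : ℝ := ((√2) ^ j)⁻¹

/-- `wt (j+1) = wt j / √2`. [cite: ChildsEtAl2003, §3.3] -/
theorem wt_succ (j : ℕ) : wt (j + 1) = wt j * (√2)⁻¹ := by
  unfold wt; rw [pow_succ, mul_inv]

/-- `wt 0 = 1` (the ENTRANCE and EXIT columns are single vertices). [cite: ChildsEtAl2003, §3.3] -/
theorem wt_zero : wt 0 = 1 := by simp [wt]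

/-- Column weights are positive. [cite: ChildsEtAl2003, §3.3] -/
theorem wt_pos (j : ℕ) : 0 < wt j := by unfold wt; positivity

/-- **The weight identity** behind `H Q = Q J`: `(1/√2) · #S(v,c) · wt(c) = wt(v) · J(col v, c)`.
[cite: ChildsEtAl2003, §3.3] -/
theorem weight_identity (hn : 1 ≤ n) (σ : CycleDatum n) (v : Vertex n) (c : L n) :
    (√2)⁻¹ * (S σ v c).card * wt c.2 = wt v.2.1 * lineH n (col v) c := by
  rw [card_S hn σ v c, lineH_apply]
  simp only [col_fst, col_snd]
  have h2 : (√2)⁻¹ * (√2)⁻¹ = (2 : ℝ)⁻¹ := by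
    rw [← mul_inv, Real.mul_self_sqrt (by norm_num : (0:ℝ) ≤ 2)]
  have hs : (√2)⁻¹ * 2 = √2 := by
    rw [inv_mul_eq_iff_eq_mul₀ (by positivity), Real.mul_self_sqrt (by norm_num : (0:ℝ) ≤ 2)]
  by_cases hb : v.1 = c.1
  · rw [if_pos hb, if_pos hb]
    by_cases h1 : (c.2 : ℕ) = v.2.1 + 1
    · rw [if_pos h1, if_pos (Or.inl h1), h1, wt_succ]
      linear_combination (2 * wt v.2.1) * h2
    · rw [if_neg h1]
      by_cases h3 : (v.2.1 : ℕ) = c.2 + 1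
      · rw [if_pos h3, if_pos (Or.inr h3), h3, wt_succ]
        have : (√2)⁻¹ ≠ 0 := by positivity
        field_simp
      · rw [if_neg h3, if_neg (by tauto)]; ring
  · rw [if_neg hb, if_neg hb]
    by_cases h : (v.2.1 : ℕ) = n ∧ (c.2 : ℕ) = n
    · rw [if_pos h, if_pos h, h.1, h.2]
      linear_combination (wt n) * hs
    · rw [if_neg h, if_neg h]; ring

/-- The column-state matrix `Q_{v,c} = [col v = c] · wt (depth v)`. [cite: ChildsEtAl2003, §3.3] -/
def Q (n : ℕ) : Matrix (Vertex n) (L n) ℂ := Matrix.of fun v c ↦ if col v = c then (wt v.2.1 : ℂ) else 0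

/-- Entries of `Q`, unfolded. [cite: ChildsEtAl2003, §3.3] -/
theorem Q_apply (v : Vertex n) (c : L n) : Q n v c = if col v = c then (wt v.2.1 : ℂ) else 0 := rfl

/-- **Invariance of the column space**: `H Q = Q J`. [cite: ChildsEtAl2003, §3.3] -/
theorem H_mul_Q (hn : 1 ≤ n) (σ : CycleDatum n) : hamiltonian n σ * Q n = Q n * lineHC n := by
  ext v c
  -- left: Σ_{u ∈ N(v)} Q u c = #S · wt c
  have hl : ((graph n σ).adjMatrix ℂ * Q n) v c = ((S σ v c).card : ℂ) * (wt c.2 : ℂ) := by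
    rw [Matrix.mul_apply]
    have e : ∀ u, (graph n σ).adjMatrix ℂ v u * Q n u c =
        if (graph n σ).Adj v u ∧ col u = c then (wt c.2 : ℂ) else 0 := by
      intro u
      rw [SimpleGraph.adjMatrix_apply, Q_apply]
      by_cases h1 : (graph n σ).Adj v u
      · by_cases h2 : col u = c
        · rw [if_pos h1, if_pos h2, if_pos ⟨h1, h2⟩, one_mul, ← h2]; rfl
        · rw [if_neg h2, mul_zero, if_neg (show ¬ ((graph n σ).Adj v u ∧ col u = c) from fun h ↦ h2 h.2)]
      · rw [if_neg h1, zero_mul, if_neg (show ¬ ((graph n σ).Adj v u ∧ col u = c) from fun h ↦ h1 h.1)]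
    simp_rw [e]
    rw [← Finset.sum_filter, Finset.sum_const, nsmul_eq_mul]
    rfl
  -- right: Σ_{c'} Q v c' J c' c = wt v · J (col v) c
  have hr : (Q n * lineHC n) v c = (wt v.2.1 : ℂ) * (lineH n (col v) c : ℂ) := by
    rw [Matrix.mul_apply]
    simp_rw [Q_apply, ite_mul, zero_mul]
    rw [Finset.sum_ite_eq, if_pos (Finset.mem_univ _)]
    rfl
  rw [hamiltonian, Matrix.smul_mul, Matrix.smul_apply, hl, hr, smul_eq_mul]
  have key := weight_identity hn σ v c
  have : ((√2)⁻¹ : ℂ) = (((√2)⁻¹ : ℝ) : ℂ) := by push_cast; rfl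
  calc ((√2 : ℂ))⁻¹ * (((S σ v c).card : ℂ) * (wt c.2 : ℂ))
      = (((√2)⁻¹ * (S σ v c).card * wt c.2 : ℝ) : ℂ) := by push_cast; ring
    _ = ((wt v.2.1 * lineH n (col v) c : ℝ) : ℂ) := by rw [key]
    _ = (wt v.2.1 : ℂ) * (lineH n (col v) c : ℂ) := by push_cast; ring

/-- The EXIT is the column `(true, 0)`. [cite: ChildsEtAl2003, §3.3] -/
theorem col_exit : col (exit n) = (true, 0) := rfl

/-- The column `(false, 0)` consists of the ENTRANCE alone. [cite: ChildsEtAl2003, §3.3] -/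
theorem col_eq_entrance_iff (v : Vertex n) : col v = (false, 0) ↔ v = entrance n := by
  constructor
  · intro h
    rw [col_eq_iff] at h
    obtain ⟨h1, h2⟩ := h
    rw [vertex_ext_iff]
    have h0 : (v.2.1 : ℕ) = 0 := by rw [h2]; rfl
    have h3 : (v.2.2 : ℕ) < 1 := by
      calc (v.2.2 : ℕ) < 2 ^ (v.2.1 : ℕ) := v.2.2.2
        _ = 1 := by rw [h0, pow_zero]
    refine ⟨h1, h0, ?_⟩
    show (v.2.2 : ℕ) = 0
    omega
  · rintro rfl; rfl

/-- The EXIT column has weight `1`. [cite: ChildsEtAl2003, §3.3] -/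
theorem wt_exit : wt ((exit n).2.1 : ℕ) = 1 := by
  rw [show ((exit n).2.1 : ℕ) = 0 from rfl, wt_zero]

/-- The ENTRANCE column has weight `1`. [cite: ChildsEtAl2003, §3.3] -/
theorem wt_entrance : wt ((entrance n).2.1 : ℕ) = 1 := by
  rw [show ((entrance n).2.1 : ℕ) = 0 from rfl, wt_zero]

/-- The EXIT row of `Q` is the indicator of the column `(true, 0)` ("the EXIT vertex corresponds to
`|col 2n⟩`"). [cite: ChildsEtAl2003, §3.4] -/
theorem Q_exit (c : L n) : Q n (exit n) c = if (true, 0) = c then 1 else 0 := by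
  rw [Q_apply, col_exit, wt_exit, Complex.ofReal_one]

/-- The `(false, 0)` column of `Q` is the indicator of the ENTRANCE ("the ENTRANCE vertex
corresponds to `|col 1⟩`"). [cite: ChildsEtAl2003, §3.4] -/
theorem Q_entrance_col (v : Vertex n) : Q n v (false, 0) = if v = entrance n then 1 else 0 := by
  rw [Q_apply]
  by_cases h : v = entrance n
  · rw [if_pos ((col_eq_entrance_iff v).mpr h), if_pos h, h, wt_entrance, Complex.ofReal_one]
  · rw [if_neg (fun h' ↦ h ((col_eq_entrance_iff v).mp h')), if_neg h]

open NormedSpace in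
open scoped Matrix.Norms.Operator in
/-- Intertwining passes to exponentials: `A Q = Q B ⟹ e^A Q = Q e^B`. [folklore] -/
theorem exp_mul_intertwine {p q : Type*} [Fintype p] [DecidableEq p] [Fintype q] [DecidableEq q]
    (A : Matrix p p ℂ) (B : Matrix q q ℂ) (P : Matrix p q ℂ) (h : A * P = P * B) :
    exp A * P = P * exp B := by
  have hpow : ∀ k : ℕ, A ^ k * P = P * B ^ k := by
    intro k
    induction k with
    | zero => simp
    | succ k ih =>
      rw [pow_succ, Matrix.mul_assoc, h, ← Matrix.mul_assoc, ih, Matrix.mul_assoc, ← pow_succ]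
  have hA : HasSum (fun k ↦ ((k.factorial : ℂ)⁻¹ • A ^ k) * P) (exp A * P) := by
    have hs := exp_series_hasSum_exp' (𝕂 := ℂ) A
    let g : Matrix p p ℂ →+ Matrix p q ℂ :=
      { toFun := fun X ↦ X * P, map_zero' := Matrix.zero_mul P, map_add' := fun X Y ↦ Matrix.add_mul X Y P }
    exact hs.map g (continuous_id.matrix_mul continuous_const)
  have hB : HasSum (fun k ↦ P * ((k.factorial : ℂ)⁻¹ • B ^ k)) (P * exp B) := by
    have hs := exp_series_hasSum_exp' (𝕂 := ℂ) B
    let g : Matrix q q ℂ →+ Matrix p q ℂ :=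
      { toFun := fun X ↦ P * X, map_zero' := Matrix.mul_zero P, map_add' := fun X Y ↦ Matrix.mul_add P X Y }
    exact hs.map g (continuous_const.matrix_mul continuous_id)
  have heq : (fun k ↦ ((k.factorial : ℂ)⁻¹ • A ^ k) * P) = (fun k ↦ P * ((k.factorial : ℂ)⁻¹ • B ^ k)) := by
    funext k; rw [Matrix.smul_mul, Matrix.mul_smul, hpow]
  rw [heq] at hA
  exact hA.unique hB

/-- The eigenvalues of the line: `E_k = 2 x_k`. [cite: ChildsEtAl2003, §3.4] -/
def Ev (n : ℕ) (k : K n) : ℝ := 2 * xs n k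

open NormedSpace in
/-- **The EXIT amplitude on `G'_n(σ)` equals the EXIT amplitude on the line**, expanded in
eigenvalues: `⟨EXIT| e^{-iHt} |ENTRANCE⟩ = Σ_k c_k e^{-i t E_k}`.
[cite: ChildsEtAl2003, §3.3 and proof of Lemma 1] -/
theorem exitAmplitude_eq (hn : 8 ≤ n) (σ : CycleDatum n) (t : ℝ) :
    exitAmplitude n σ t = ∑ k : K n, (coef n k : ℂ) * Complex.exp ((-(t * Ev n k) : ℝ) * Complex.I) := by
  unfold exitAmplitude
  set c : ℂ := -(t : ℂ) * Complex.I with hc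
  have key := exp_mul_intertwine (c • hamiltonian n σ) (c • lineHC n) (Q n)
    (by rw [Matrix.smul_mul, Matrix.mul_smul, H_mul_Q (by omega) σ])
  have e1 : exp (c • hamiltonian n σ) (exit n) (entrance n) =
      (exp (c • hamiltonian n σ) * Q n) (exit n) (false, 0) := by
    rw [Matrix.mul_apply]
    simp_rw [Q_entrance_col, mul_ite, mul_one, mul_zero]
    rw [Finset.sum_ite_eq', if_pos (Finset.mem_univ _)]
  have e2 : (Q n * exp (c • lineHC n)) (exit n) (false, 0) = exp (c • lineHC n) (true, 0) (false, 0) := by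
    rw [Matrix.mul_apply]
    simp_rw [Q_exit, ite_mul, one_mul, zero_mul]
    rw [Finset.sum_ite_eq, if_pos (Finset.mem_univ _)]
  rw [e1, key, e2, exp_smul_lineHC_exit_entrance hn c]
  refine Finset.sum_congr rfl fun k _ ↦ ?_
  congr 2
  rw [hc, Ev]; push_cast; ring

end column

/-! ### Assembly: Theorem 3 -/

/-- The eigenvalues `E_k = 2x_k` are pairwise `6/(n+1)³`-separated (`ΔE > 4/N³` is what the
real-form Lemma 1 needs with `τ = N⁴/(2ε)`). [cite: ChildsEtAl2003, Lemma 2] -/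
theorem Ev_sep {n : ℕ} (hn : 8 ≤ n) (k k' : K n) (h : k ≠ k') :
    6 / ((n : ℝ) + 1) ^ 3 ≤ |Ev n k - Ev n k'| := by
  have := xs_sep hn h
  rw [Ev, Ev, ← mul_sub, abs_mul, abs_two,
    show (6 : ℝ) / ((n : ℝ) + 1) ^ 3 = 2 * (3 / ((n : ℝ) + 1) ^ 3) by ring]
  linarith

end Thm3

open GluedTrees GluedTrees.Thm3 in
/-- **Theorem 3 of [ChildsEtAl2003] holds** (with `n₀ = 8`, i.e. for the graphs `G'_n`, `n ≥ 8`):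
the column-space reduction (§3.3), the explicit eigenpairs of the line with a `√2` defect and
their separation `ΔE ≥ 6/(n+1)³` (a bracketing version of Lemma 2), and the time-average bound
(Lemma 1, in the sharper real form `≥ 1/(2N) - 1/(τ ΔE)`). [cite: ChildsEtAl2003, Theorem 3, §3.3–3.4] -/
theorem _root_.Literature.Computability.QuantumComplexity.ChildsEtAl2003_thm3_holds :
    ChildsEtAl2003_thm3 := by
  intro ε hε
  refine ⟨8, fun n hn σ ↦ ?_⟩
  have hN : (0 : ℝ) < (n : ℝ) + 1 := by positivity
  set τ : ℝ := ((n : ℝ) + 1) ^ 4 / (2 * ε) with hτ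
  have hτ0 : 0 < τ := by positivity
  have hamp : ∀ t, ‖exitAmplitude n σ t‖ ^ 2 =
      ‖∑ k : K n, (coef n k : ℂ) * Complex.exp ((-(t * Ev n k) : ℝ) * Complex.I)‖ ^ 2 := by
    intro t; rw [exitAmplitude_eq hn]
  simp_rw [hamp]
  have hδ : (0 : ℝ) < 6 / ((n : ℝ) + 1) ^ 3 := by positivity
  have hlow := integral_norm_sq_lower (coef n) (Ev n) τ hδ (fun k k' h ↦ Ev_sep hn k k' h)
  rw [sum_abs_coef hn, one_pow] at hlow
  have hcs := sum_coef_sq hn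
  have hfac : (0 : ℝ) ≤ 2 * ε / ((n : ℝ) + 1) ^ 4 := by positivity
  calc (1 - ε) / (2 * ((n : ℝ) + 1)) < 1 / (2 * ((n : ℝ) + 1)) - ε / (3 * ((n : ℝ) + 1)) := by
        rw [div_sub_div _ _ (by positivity) (by positivity), div_lt_div_iff₀ (by positivity) (by positivity)]
        nlinarith [mul_pos (mul_pos hN hN) hε]
    _ = 2 * ε / ((n : ℝ) + 1) ^ 4 * (τ * (1 / (2 * ((n : ℝ) + 1))) - 1 / (6 / ((n : ℝ) + 1) ^ 3)) := by
        rw [hτ]; field_simp; ring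
    _ ≤ 2 * ε / ((n : ℝ) + 1) ^ 4 * (τ * ∑ k : K n, coef n k ^ 2 - 1 / (6 / ((n : ℝ) + 1) ^ 3)) := by
        gcongr
    _ ≤ 2 * ε / ((n : ℝ) + 1) ^ 4 *
          ∫ t in (0 : ℝ)..τ, ‖∑ k : K n, (coef n k : ℂ) * Complex.exp ((-(t * Ev n k) : ℝ) * Complex.I)‖ ^ 2 :=
        mul_le_mul_of_nonneg_left hlow hfac

end Literature.Computability.QuantumComplexity.GluedTrees

end
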